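import Literature.InformationTheory.Coding.CosetWeightsNPComplete
import HarnessLib

/-!
# Kapshikar–Kundu 2023, Corollary 3: the minimum-distance problem for CSS codes is NP-hard — PROVED

Discharge of the named fact `KapshikarKundu2023_cssMinimumDistance_isNPHard : IsNPHard CSSMINDIST`
of `QuantumCodes/MinimumDistanceHardness.lean` (U. Kapshikar, S. Kundu, *On the hardness of the
minimum distance problem of quantum codes*, IEEE Trans. Inform. Theory 69 (2023) 6293–6302 =
arXiv:2203.04262, §4.1 Corollary 3: "The minimum distance problem for CSS codes is NP-hard").

## Proof route (this file; NOT the printed one)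

The printed proofs reduce Vardy's MINIMUM DISTANCE (`Vardy1997_minimumDistance_isNPComplete`,
a named fact of the tree) to the quantum problem: [KapshikarKundu2023, §4] through codeword-stabilized
codes on Erdős–Rényi–Sós polarity graphs and the Bravyi–Terhal–Leemhuis stabilizer → CSS map,
[GrigorescuJhaSamperton2025, §3] through hypergraph products. Here the source problem is instead
COSET WEIGHTS (maximum-likelihood decoding), whose NP-hardness is a THEOREM of the tree
(`BerlekampMcElieceVanTilborg1978_cosetWeights_isNPHard`, `Coding/DecodingHardness.lean`), and the
reduction `COSETWEIGHTS ≤ₚ CSSMINDIST` is the following elementary construction. Given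
`A ∈ 𝔽₂^{m × n}`, `y ∈ 𝔽₂ⁿ`, `w` (question: `∃ x, |x| ≤ w ∧ xA = y`), let `A' = (A; y)` (the
`(m+1) × n` matrix with last row `y`), index classical coordinates by
`(a, b) ∈ Fin (n+1) × Fin (m+1)` and qubits by `((a,b), j)`, `j ∈ Fin (m+2)`. The systematic
classical code `C₁ = rowspace [I_{m+1} | A' ⊗ 1_{m+1}]` has EXPLICIT generators
`g_b` (`b ≤ m`) AND explicit parity checks `r_{(e,σ)}` (`e < n`, `σ ≤ m`); `C = ⟨g_b : b < m⟩`.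
The CSS code has X-stabilizers `r_{(e,σ)} ⊗ 1_{m+2}` and Z-stabilizers
`g_i ⊗ e₀` (`i < m`) together with the `e_{(c,0)} + e_{(c,j)}`; its Z-logicals are exactly the
vectors whose block sums lie in `C₁ ∖ C = {(x, 1, (xA + y) ⊗ 1_{m+1})}`, of least weight
`min_x (|x| + 1 + (m+1)|xA + y|)`, and its X-logicals are `u ⊗ 1_{m+2}` with `u ≠ 0`, of weight
`≥ m + 2`. With the threshold `t = min(w, m) + 1 ≤ m + 1` the CSS instance is a YES instance iff
the COSET WEIGHTS instance is (`CSSDistHard.flat_mem_iff`). No Gaussian elimination is needed,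
so the map is assembled from the tree's string bricks (`CSSDistHard.outF ∈ FP`), with the
COSET WEIGHTS instance test `CosetWeightsNP.T` of `CosetWeightsNPComplete.lean` as the guard.

Main declarations:
* `CSSDistHard.flat_mem_iff` — the instance `CSSDistHard.flatInst m n A y w` is in
  `cssMinimumDistanceSet` iff `(⟨m, n, A, y⟩, w) ∈ cosetWeightsSet`;
* `CSSDistHard.COSETWEIGHTS_karpReducible_CSSMINDIST : COSETWEIGHTS ≤ₚ CSSMINDIST`;
* **`KapshikarKundu2023_cssMinimumDistance_isNPHard_holds`**.

## References

* [KapshikarKundu2023] U. Kapshikar, S. Kundu, IEEE Trans. Inform. Theory 69 (2023) 6293–6302 =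
  arXiv:2203.04262 (held: `paper:arxiv-2203.04262`), §3 Problem 4, §4 Theorem 2, §4.1 Corollary 3
  (chunk p0015: "Corollary 3. The minimum distance problem for CSS codes is NP-hard.").
* [BerlekampMcelieceVantilborg1978] E. R. Berlekamp, R. J. McEliece, H. C. A. van Tilborg, IEEE
  Trans. Inform. Theory 24 (1978) 384–386, §III.A (COSET WEIGHTS).
* [GrigorescuJhaSamperton2025] E. Grigorescu, V. Jha, E. Samperton, *On the hardness of
  approximating minimum distances of quantum codes*, FSTTCS 2025 = arXiv:2509.21469, §3 (a second
  printed route, also from MINIMUM DISTANCE).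
* [AroraBarak2009] S. Arora, B. Barak, *Computational Complexity*, CUP 2009, §0.1, §1.3, Def. 2.7.

## Mathlib / tree search

`lean search 'CSSMINDIST|cssMinimumDistanceSet|quantumMinimumDistanceSet'` (2026-08-27): only the
statement file `MinimumDistanceHardness.lean`; no reduction to a quantum distance problem exists in
the tree. Reused: `COSETWEIGHTS`, `cosetWeightsSet`, `CosetWeights.encode_finVec_F2`
(`DecodingHardness.lean`); the instance test `CosetWeightsNP.T`, `GoodShape`, `encode_instOf`,
`goodShape_encode`, the field readers `mOf/nOf/wOf/item/yvOf/AOf/yvecOf` and the bricks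
`mhatF/nhatF/itemF/yvF` (`CosetWeightsNPComplete.lean`); `cssRowSpan`, `sympDual`, `sympWeight`,
`IsSelfOrthogonal` (`SymplecticCodes.lean`, `MinimumDistanceHardness.lean`).
-/

noncomputable section

namespace Literature.InformationTheory.QuantumCodes

open _root_.Computability Literature.Computability.Complexity Literature.InformationTheory.Coding
open scoped Literature.Computability.Complexity.Notation

namespace CSSDistHard

/-! ### Small facts over `𝔽₂` -/

/-- Every element of `𝔽₂` is `0` or `1`. [folklore] -/
private theorem zmod2_cases (a : ZMod 2) : a = 0 ∨ a = 1 := by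
  revert a; decide

/-- In `𝔽₂`, nonzero means `1`. [folklore] -/
private theorem zmod2_ne_zero_iff (a : ZMod 2) : a ≠ 0 ↔ a = 1 := by
  revert a; decide

/-- In `𝔽₂`, `a + b = 0 ↔ a = b`. [folklore] -/
private theorem zmod2_add_eq_zero_iff (a b : ZMod 2) : a + b = 0 ↔ a = b := by
  revert a b; decide

/-- In `𝔽₂`, `a + a = 0`. [folklore] -/
private theorem zmod2_add_self (a : ZMod 2) : a + a = 0 := by
  revert a; decide

/-! ### Index types of the construction -/

variable {m n : ℕ}

/-- Classical coordinates `(a, b)`: `a = 0` is the selector block (`b < m`: row selector `x_b`,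
`b = m`: the coset selector `λ`), `a = e + 1` is copy `b` of column `e` of `A' = (A; y)`.
[cite: KapshikarKundu2023, §4.1 Corollary 3 (statement); construction of this file] -/
abbrev CIdx (m n : ℕ) : Type := Fin (n + 1) × Fin (m + 1)

/-- Qubits `((a, b), j)`: `m + 2` copies `j` of each classical coordinate. [construction of this file] [cite: KapshikarKundu2023, §4.1 Corollary 3 (statement)] -/
abbrev QIdx (m n : ℕ) : Type := CIdx m n × Fin (m + 2)

/-- X-check indices `(e, σ)`: one parity check of the systematic code per column `e` of `A'` and copy `σ`.
[construction of this file] [cite: KapshikarKundu2023, §4.1 Corollary 3 (statement)] -/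
abbrev XIdx (m n : ℕ) : Type := Fin n × Fin (m + 1)

variable (A : Fin m → Fin n → ZMod 2) (y : Fin n → ZMod 2)

/-- `A' = (A; y)`: the matrix `A` with the target vector `y` appended as row `m`.
[cite: BerlekampMcelieceVantilborg1978, §III.A (p. 385: inputs A, y)] -/
def A' : Fin (m + 1) → Fin n → ZMod 2 := Fin.snoc (α := fun _ => Fin n → ZMod 2) A y

/-- Rows of `A' = (A; y)`. [cite: BerlekampMcelieceVantilborg1978, §III.A (p. 385: inputs A, y)] -/
@[simp] theorem A'_castSucc (i : Fin m) : A' A y i.castSucc = A i := by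
  simp [A']

/-- Rows of `A' = (A; y)`. [cite: BerlekampMcelieceVantilborg1978, §III.A (p. 385: inputs A, y)] -/
@[simp] theorem A'_last : A' A y (Fin.last m) = y := by
  simp [A']

/-! ### The classical vectors: generators `g_b` and parity checks `r_ξ` of the systematic code -/

/-- **Generator `g_b`** of `C₁ = rowspace [I_{m+1} | A' ⊗ 1_{m+1}]`: `e_b` on the selector block and
`A'_{b,e}` on every copy of column `e`. For `b < m` these generate `C`, `g_m = (e_λ ; y ⊗ 1)` is the
coset representative. [construction of this file] [cite: BerlekampMcelieceVantilborg1978, §III.A (p. 385)] -/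
def gvec (b : Fin (m + 1)) (c : CIdx m n) : ZMod 2 :=
  if h : c.1 = 0 then (if c.2 = b then 1 else 0) else A' A y b (c.1.pred h)

/-- **Parity check `r_{(e,σ)}`** of `C₁`: `A'_{·,e}` on the selector block and `1` at copy `σ` of
column `e`. [construction of this file] [cite: BerlekampMcelieceVantilborg1978, §III.A (p. 385)] -/
def rvec (ξ : XIdx m n) (c : CIdx m n) : ZMod 2 :=
  if c.1 = 0 then A' A y c.2 ξ.1 else if c.1 = ξ.1.succ ∧ c.2 = ξ.2 then 1 else 0

/-- Value of `g_b` on the selector block. [construction of this file] [cite: BerlekampMcelieceVantilborg1978, §III.A (p. 385)] -/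
@[simp] theorem gvec_zero (b b' : Fin (m + 1)) : gvec A y b (0, b') = if b' = b then 1 else 0 := by
  simp [gvec]

/-- Value of `g_b` on copy `σ` of column `e`. [construction of this file] [cite: BerlekampMcelieceVantilborg1978, §III.A (p. 385)] -/
@[simp] theorem gvec_succ (b : Fin (m + 1)) (e : Fin n) (σ : Fin (m + 1)) :
    gvec A y b (e.succ, σ) = A' A y b e := by
  simp [gvec, Fin.succ_ne_zero]

/-- Value of `r_ξ` on the selector block. [construction of this file] [cite: BerlekampMcelieceVantilborg1978, §III.A (p. 385)] -/
@[simp] theorem rvec_zero (ξ : XIdx m n) (b' : Fin (m + 1)) : rvec A y ξ (0, b') = A' A y b' ξ.1 := by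
  simp [rvec]

/-- Value of `r_ξ` on copy `σ` of column `e`. [construction of this file] [cite: BerlekampMcelieceVantilborg1978, §III.A (p. 385)] -/
@[simp] theorem rvec_succ (ξ : XIdx m n) (e : Fin n) (σ : Fin (m + 1)) :
    rvec A y ξ (e.succ, σ) = if e = ξ.1 ∧ σ = ξ.2 then 1 else 0 := by
  simp [rvec, Fin.succ_ne_zero, Fin.succ_inj]

/-- A dot product over the classical coordinates splits into the selector block and the column
copies. [folklore] -/
private theorem dot_CIdx (u v : CIdx m n → ZMod 2) :
    u ⬝ᵥ v = (∑ b, u (0, b) * v (0, b)) + ∑ e : Fin n, ∑ σ : Fin (m + 1), u (e.succ, σ) * v (e.succ, σ) := by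
  rw [dotProduct, Fintype.sum_prod_type, Fin.sum_univ_succ]

/-- **The parity checks annihilate the generators**: `r_ξ · g_b = A'_{b,e} + A'_{b,e} = 0`.
[construction of this file] [cite: BerlekampMcelieceVantilborg1978, §III.A (p. 385)] -/
theorem rvec_dot_gvec (ξ : XIdx m n) (b : Fin (m + 1)) : rvec A y ξ ⬝ᵥ gvec A y b = 0 := by
  rw [dot_CIdx]
  simp only [rvec_zero, gvec_zero, rvec_succ, gvec_succ, mul_ite, mul_one, mul_zero,
    Finset.sum_ite_eq', Finset.mem_univ, if_true, ite_mul, one_mul, zero_mul]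
  have h2 : ∑ e : Fin n, ∑ σ : Fin (m + 1), (if e = ξ.1 ∧ σ = ξ.2 then A' A y b e else 0) = A' A y b ξ.1 := by
    rw [Finset.sum_eq_single ξ.1 (fun e _ he => by simp [he]) (by simp)]
    rw [Finset.sum_eq_single ξ.2 (fun σ _ hσ => by simp [hσ]) (by simp)]
    simp
  rw [h2, zmod2_add_self]

/-- The dot product of `r_ξ` with any classical vector. [construction of this file] [cite: BerlekampMcelieceVantilborg1978, §III.A (p. 385)] -/
theorem rvec_dot (ξ : XIdx m n) (v : CIdx m n → ZMod 2) :
    rvec A y ξ ⬝ᵥ v = (∑ b, A' A y b ξ.1 * v (0, b)) + v (ξ.1.succ, ξ.2) := by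
  rw [dot_CIdx]
  simp only [rvec_zero, rvec_succ, ite_mul, one_mul, zero_mul]
  congr 1
  rw [Finset.sum_eq_single ξ.1 (fun e _ he => by simp [he]) (by simp)]
  rw [Finset.sum_eq_single ξ.2 (fun σ _ hσ => by simp [hσ]) (by simp)]
  simp

/-- The dot product of `g_b` with any classical vector. [construction of this file] [cite: BerlekampMcelieceVantilborg1978, §III.A (p. 385)] -/
theorem gvec_dot (b : Fin (m + 1)) (u : CIdx m n → ZMod 2) :
    u ⬝ᵥ gvec A y b = u (0, b) + ∑ e : Fin n, ∑ σ : Fin (m + 1), u (e.succ, σ) * A' A y b e := by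
  rw [dot_CIdx]
  simp only [gvec_zero, gvec_succ, mul_ite, mul_one, mul_zero, Finset.sum_ite_eq', Finset.mem_univ, if_true]

/-- **The parity checks are complete**: a classical vector annihilated by every `r_ξ` is the
combination `Σ_b v_{(0,b)} g_b` of the generators (read off the selector block).
[construction of this file] [cite: BerlekampMcelieceVantilborg1978, §III.A (p. 385)] -/
theorem eq_sum_gvec_of_rvec_dot {v : CIdx m n → ZMod 2} (h : ∀ ξ : XIdx m n, rvec A y ξ ⬝ᵥ v = 0)
    (c : CIdx m n) : v c = ∑ b, v (0, b) * gvec A y b c := by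
  obtain ⟨a, b'⟩ := c
  induction a using Fin.cases with
  | zero =>
    simp only [gvec_zero, mul_ite, mul_one, mul_zero]
    rw [Finset.sum_ite_eq]
    simp
  | succ e =>
    simp only [gvec_succ]
    have h1 := h (e, b')
    rw [rvec_dot, zmod2_add_eq_zero_iff] at h1
    rw [← h1]
    exact Finset.sum_congr rfl fun b _ => mul_comm _ _

/-- **The generators are complete on the dual side**: a classical vector orthogonal to every `g_b`
is the combination `Σ_ξ u_{(e+1,σ)} r_ξ` of the parity checks (read off the column copies).
[construction of this file] [cite: BerlekampMcelieceVantilborg1978, §III.A (p. 385)] -/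
theorem eq_sum_rvec_of_dot_gvec {u : CIdx m n → ZMod 2} (h : ∀ b : Fin (m + 1), u ⬝ᵥ gvec A y b = 0)
    (c : CIdx m n) : u c = ∑ ξ : XIdx m n, u (ξ.1.succ, ξ.2) * rvec A y ξ c := by
  obtain ⟨a, b'⟩ := c
  rw [Fintype.sum_prod_type]
  induction a using Fin.cases with
  | zero =>
    simp only [rvec_zero]
    have h1 := h b'
    rw [gvec_dot, zmod2_add_eq_zero_iff] at h1
    exact h1
  | succ e =>
    simp only [rvec_succ, mul_ite, mul_one, mul_zero]
    rw [Finset.sum_eq_single e (fun e' _ he' => by simp [Ne.symm he']) (by simp)]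
    rw [Finset.sum_eq_single b' (fun σ _ hσ => by simp [Ne.symm hσ]) (by simp)]
    simp

/-! ### Blow-up: `m + 2` qubits per classical coordinate -/

/-- Block sums `π(z)_c = Σ_j z_{(c,j)}`. [construction of this file] [cite: KapshikarKundu2023, §4.1 Corollary 3 (statement)] -/
def proj (z : QIdx m n → ZMod 2) (c : CIdx m n) : ZMod 2 := ∑ j, z (c, j)

/-- `u ⊗ 1_{m+2}`: the same value on every copy. [construction of this file] [cite: KapshikarKundu2023, §4.1 Corollary 3 (statement)] -/
def rep (u : CIdx m n → ZMod 2) (q : QIdx m n) : ZMod 2 := u q.1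

/-- `v ⊗ e₀`: the value on copy `0` only. [construction of this file] [cite: KapshikarKundu2023, §4.1 Corollary 3 (statement)] -/
def lift (v : CIdx m n → ZMod 2) (q : QIdx m n) : ZMod 2 := if q.2 = 0 then v q.1 else 0

/-- The Z-stabilizer `e_{(c,0)} + e_{(c,j)}` (zero for `j = 0`), generators of `ker π`.
[construction of this file] [cite: KapshikarKundu2023, §4.1 Corollary 3 (statement)] -/
def kvec (q' q : QIdx m n) : ZMod 2 :=
  if q.1 = q'.1 then (if q.2 = 0 then 1 else 0) + (if q.2 = q'.2 then 1 else 0) else 0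

/-- `(u ⊗ 1) · z = u · π(z)`. [construction of this file] [cite: KapshikarKundu2023, §4.1 Corollary 3 (statement)] -/
theorem rep_dot (u : CIdx m n → ZMod 2) (z : QIdx m n → ZMod 2) : rep u ⬝ᵥ z = u ⬝ᵥ proj z := by
  simp only [dotProduct, rep, proj, Fintype.sum_prod_type, Finset.mul_sum]

/-- `π(v ⊗ e₀) = v`. [construction of this file] [cite: KapshikarKundu2023, §4.1 Corollary 3 (statement)] -/
@[simp] theorem proj_lift (v : CIdx m n → ZMod 2) : proj (lift v) = v := by
  funext c
  simp [proj, lift, Finset.sum_ite_eq']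

/-- `π(e_{(c,0)} + e_{(c,j)}) = 0`. [construction of this file] [cite: KapshikarKundu2023, §4.1 Corollary 3 (statement)] -/
@[simp] theorem proj_kvec (q' : QIdx m n) : proj (kvec q') = 0 := by
  funext c
  simp only [proj, kvec, Pi.zero_apply]
  split_ifs with h
  · rw [Finset.sum_add_distrib, Finset.sum_ite_eq', Finset.sum_ite_eq']
    simp [zmod2_add_self]
  · simp

/-- `x · (e_{(c',0)} + e_{(c',j')}) = x_{(c',0)} + x_{(c',j')}`. [construction of this file] [cite: KapshikarKundu2023, §4.1 Corollary 3 (statement)] -/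
theorem dot_kvec (x : QIdx m n → ZMod 2) (q' : QIdx m n) : x ⬝ᵥ kvec q' = x (q'.1, 0) + x q' := by
  obtain ⟨c', j'⟩ := q'
  rw [dotProduct, Fintype.sum_prod_type]
  rw [Finset.sum_eq_single c' (fun c _ hc => by simp [kvec, hc]) (by simp)]
  simp only [kvec, if_true, mul_add, mul_ite, mul_one, mul_zero, Finset.sum_add_distrib]
  rw [Finset.sum_ite_eq', Finset.sum_ite_eq']
  simp

/-- `x · (v ⊗ e₀) = (x restricted to copy 0) · v`. [construction of this file] [cite: KapshikarKundu2023, §4.1 Corollary 3 (statement)] -/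
theorem dot_lift (x : QIdx m n → ZMod 2) (v : CIdx m n → ZMod 2) :
    x ⬝ᵥ lift v = (fun c => x (c, 0)) ⬝ᵥ v := by
  rw [dotProduct, dotProduct, Fintype.sum_prod_type]
  refine Finset.sum_congr rfl fun c _ => ?_
  simp only [lift, mul_ite, mul_zero]
  rw [Finset.sum_ite_eq']
  simp

/-- A vector orthogonal to all the `e_{(c,0)} + e_{(c,j)}` is constant on blocks: `x = (x|₀) ⊗ 1`.
[construction of this file] [cite: KapshikarKundu2023, §4.1 Corollary 3 (statement)] -/
theorem eq_rep_of_dot_kvec {x : QIdx m n → ZMod 2} (h : ∀ q', x ⬝ᵥ kvec q' = 0) :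
    x = rep (fun c => x (c, 0)) := by
  funext q
  have h1 := h q
  rw [dot_kvec, zmod2_add_eq_zero_iff] at h1
  exact h1.symm

/-- **`ker π` and the lifted generators span the Z-side**: if `π(z) ∈ C` (every parity check
vanishes on `π(z)` and its coset selector is `0`) then
`z = Σ_{q'} z_{q'} (e_{(c',0)} + e_{q'}) + Σ_{i<m} π(z)_{(0,i)} (g_i ⊗ e₀)`.
[construction of this file] [cite: KapshikarKundu2023, §4.1 Corollary 3 (statement)] -/
theorem eq_sum_zside {z : QIdx m n → ZMod 2} (h : ∀ ξ : XIdx m n, rvec A y ξ ⬝ᵥ proj z = 0)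
    (hlast : proj z (0, Fin.last m) = 0) (q : QIdx m n) :
    z q = (∑ q' : QIdx m n, z q' * kvec q' q) +
      ∑ i : Fin m, proj z (0, i.castSucc) * lift (gvec A y i.castSucc) q := by
  obtain ⟨c, j⟩ := q
  -- the `kvec` part: `[j = 0] π(z)_c + z_{(c,j)}`
  have hk : ∑ q' : QIdx m n, z q' * kvec q' (c, j) = (if j = 0 then proj z c else 0) + z (c, j) := by
    rw [Fintype.sum_prod_type]
    rw [Finset.sum_eq_single c (fun c' _ hc' => by simp [kvec, Ne.symm hc']) (by simp)]
    simp only [kvec, if_true, mul_add, mul_ite, mul_one, mul_zero, Finset.sum_add_distrib]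
    congr 1
    · split_ifs with hj
      · simp [proj]
      · simp
    · rw [Finset.sum_eq_single j (fun j' _ hj' => by simp [Ne.symm hj']) (by simp)]
      simp
  -- the `lift` part: `[j = 0] (Σ_b π(z)_{(0,b)} g_b(c) - π(z)_{(0,m)} g_m(c)) = [j = 0] π(z)_c`
  have hl : ∑ i : Fin m, proj z (0, i.castSucc) * lift (gvec A y i.castSucc) (c, j) =
      if j = 0 then proj z c else 0 := by
    simp only [lift, mul_ite, mul_zero]
    split_ifs with hj
    · rw [eq_sum_gvec_of_rvec_dot A y h c, Fin.sum_univ_castSucc, hlast, zero_mul, add_zero]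
    · simp
  rw [hk, hl]
  split_ifs with hj
  · rw [add_comm (proj z c) (z (c, j)), add_assoc, zmod2_add_self, add_zero]
  · rw [zero_add, add_zero]

/-! ### Weights -/

/-- The support of a function on a finite type, as a `Finset` (so `hammingNorm x = #(supp x)`). [folklore] -/
private theorem hammingNorm_eq_card {ι : Type} [Fintype ι] [DecidableEq ι] (x : ι → ZMod 2) :
    hammingNorm x = (Finset.univ.filter fun i => x i ≠ 0).card := rfl

/-- `|π(z)| ≤ |z|`: every nonzero block sum has a nonzero entry in its block.
[construction of this file] [cite: KapshikarKundu2023, §4.1 Corollary 3 (statement)] -/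
theorem hammingNorm_proj_le (z : QIdx m n → ZMod 2) : hammingNorm (proj z) ≤ hammingNorm z := by
  classical
  rw [hammingNorm_eq_card, hammingNorm_eq_card]
  -- choose a nonzero entry in each nonzero block
  have hch : ∀ c ∈ (Finset.univ.filter fun c => proj z c ≠ 0), ∃ j, z (c, j) ≠ 0 := by
    intro c hc
    rw [Finset.mem_filter] at hc
    by_contra hno
    push Not at hno
    apply hc.2
    simp only [proj]
    exact Finset.sum_eq_zero fun j _ => hno j
  choose! jc hjc using hch
  refine Finset.card_le_card_of_injOn (fun c => (c, jc c)) (fun c hc => ?_) (fun c hc c' hc' h => ?_)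
  · rw [Finset.mem_coe, Finset.mem_filter]
    exact ⟨Finset.mem_univ _, hjc c hc⟩
  · exact (Prod.mk.inj h).1

/-- `|u ⊗ 1| ≥ m + 2` if `u ≠ 0`: a nonzero coordinate is repeated on all its `m + 2` copies.
[construction of this file] [cite: KapshikarKundu2023, §4.1 Corollary 3 (statement)] -/
theorem le_hammingNorm_rep {u : CIdx m n → ZMod 2} {c : CIdx m n} (hc : u c ≠ 0) :
    m + 2 ≤ hammingNorm (rep u) := by
  classical
  rw [hammingNorm_eq_card]
  have hcard : (Finset.univ.image fun j : Fin (m + 2) => (c, j)).card = m + 2 := by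
    rw [Finset.card_image_of_injective _ (fun j j' h => (Prod.mk.inj h).2), Finset.card_univ, Fintype.card_fin]
  have hle : (Finset.univ.image fun j : Fin (m + 2) => (c, j)).card ≤
      (Finset.univ.filter fun q : QIdx m n => rep u q ≠ 0).card := by
    refine Finset.card_le_card fun q hq => ?_
    rw [Finset.mem_image] at hq
    obtain ⟨j, -, rfl⟩ := hq
    rw [Finset.mem_filter]
    exact ⟨Finset.mem_univ _, hc⟩
  rwa [hcard] at hle

/-- `|v ⊗ e₀| ≤ |v|`. [construction of this file] [cite: KapshikarKundu2023, §4.1 Corollary 3 (statement)] -/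
theorem hammingNorm_lift_le (v : CIdx m n → ZMod 2) : hammingNorm (lift v) ≤ hammingNorm v := by
  classical
  rw [hammingNorm_eq_card, hammingNorm_eq_card]
  refine Finset.card_le_card_of_injOn (fun q => q.1) (fun q hq => ?_) (fun q hq q' hq' h => ?_)
  · rw [Finset.mem_coe, Finset.mem_filter] at hq ⊢
    obtain ⟨-, hq⟩ := hq
    simp only [lift] at hq
    split_ifs at hq with h0
    · exact ⟨Finset.mem_univ _, hq⟩
    · exact absurd rfl hq
  · rw [Finset.mem_coe, Finset.mem_filter] at hq hq'
    have j0 : q.2 = 0 := by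
      by_contra hj; exact hq.2 (by simp [lift, hj])
    have j0' : q'.2 = 0 := by
      by_contra hj; exact hq'.2 (by simp [lift, hj])
    exact Prod.ext h (j0.trans j0'.symm)

/-- The selector-block vector `(x, λ ; 0)` of a row selector `x` and coset selector `λ`.
[construction of this file] [cite: BerlekampMcelieceVantilborg1978, §III.A (p. 385)] -/
def selVec (xl : Fin (m + 1) → ZMod 2) (c : CIdx m n) : ZMod 2 := if c.1 = 0 then xl c.2 else 0

/-- `|(x, 1 ; 0)| ≤ |x| + 1`. [construction of this file] [cite: BerlekampMcelieceVantilborg1978, §III.A (p. 385)] -/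
theorem hammingNorm_selVec_snoc_le (x : Fin m → ZMod 2) :
    hammingNorm (selVec (n := n) (Fin.snoc x 1)) ≤ hammingNorm x + 1 := by
  classical
  rw [hammingNorm_eq_card, hammingNorm_eq_card]
  -- support ⊆ {(0, castSucc i) : x i ≠ 0} ∪ {(0, last)}
  have hsub : (Finset.univ.filter fun c : CIdx m n => selVec (Fin.snoc x 1) c ≠ 0) ⊆
      insert ((0 : Fin (n + 1)), Fin.last m)
        ((Finset.univ.filter fun i : Fin m => x i ≠ 0).image fun i => ((0 : Fin (n + 1)), i.castSucc)) := by
    intro c hc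
    rw [Finset.mem_filter] at hc
    obtain ⟨a, b⟩ := c
    simp only [selVec] at hc
    split_ifs at hc with ha
    · subst ha
      rw [Finset.mem_insert, Finset.mem_image]
      induction b using Fin.lastCases with
      | last => exact Or.inl rfl
      | cast i =>
        right
        refine ⟨i, ?_, rfl⟩
        rw [Finset.mem_filter]
        rw [Fin.snoc_castSucc] at hc
        exact ⟨Finset.mem_univ _, hc.2⟩
    · exact absurd rfl hc.2
  refine (Finset.card_le_card hsub).trans ((Finset.card_insert_le _ _).trans ?_)
  rw [Nat.add_le_add_iff_right]
  exact Finset.card_image_le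

/-- Conversely `|x| + 1 ≤ |v|` when `v` carries `x` on the selector block and has coset selector `≠ 0`.
[construction of this file] [cite: BerlekampMcelieceVantilborg1978, §III.A (p. 385)] -/
theorem hammingNorm_add_one_le {v : CIdx m n → ZMod 2} (hlast : v (0, Fin.last m) ≠ 0) :
    hammingNorm (fun i : Fin m => v (0, i.castSucc)) + 1 ≤ hammingNorm v := by
  classical
  rw [hammingNorm_eq_card, hammingNorm_eq_card]
  have h1 : ((Finset.univ.filter fun i : Fin m => v (0, i.castSucc) ≠ 0).image
      fun i => ((0 : Fin (n + 1)), i.castSucc)).card = (Finset.univ.filter fun i : Fin m => v (0, i.castSucc) ≠ 0).card :=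
    Finset.card_image_of_injective _ fun i i' h => Fin.castSucc_injective _ (Prod.mk.inj h).2
  rw [← h1, ← Finset.card_insert_of_notMem (a := ((0 : Fin (n + 1)), Fin.last m))
    (by
      rw [Finset.mem_image]
      rintro ⟨i, -, h⟩
      exact (Fin.castSucc_lt_last i).ne (Prod.mk.inj h).2)]
  refine Finset.card_le_card fun c hc => ?_
  rw [Finset.mem_insert] at hc
  rw [Finset.mem_filter]
  rcases hc with rfl | hc
  · exact ⟨Finset.mem_univ _, hlast⟩
  · rw [Finset.mem_image] at hc
    obtain ⟨i, hi, rfl⟩ := hc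
    rw [Finset.mem_filter] at hi
    exact ⟨Finset.mem_univ _, hi.2⟩

/-- If the coset selector of `v` is nonzero and some column copy block is entirely nonzero then
`|v| ≥ m + 2`. [construction of this file] [cite: BerlekampMcelieceVantilborg1978, §III.A (p. 385)] -/
theorem le_hammingNorm_of_column {v : CIdx m n → ZMod 2} (hlast : v (0, Fin.last m) ≠ 0) {e : Fin n}
    (he : ∀ σ : Fin (m + 1), v (e.succ, σ) ≠ 0) : m + 2 ≤ hammingNorm v := by
  classical
  rw [hammingNorm_eq_card]
  have h1 : ((Finset.univ : Finset (Fin (m + 1))).image fun σ => (e.succ, σ)).card = m + 1 := by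
    rw [Finset.card_image_of_injective _ (fun σ σ' h => (Prod.mk.inj h).2), Finset.card_univ, Fintype.card_fin]
  have h2 : ((0 : Fin (n + 1)), Fin.last m) ∉ (Finset.univ : Finset (Fin (m + 1))).image fun σ => (e.succ, σ) := by
    rw [Finset.mem_image]
    rintro ⟨σ, -, h⟩
    exact Fin.succ_ne_zero e (Prod.mk.inj h).1
  have hle : (insert ((0 : Fin (n + 1)), Fin.last m)
      ((Finset.univ : Finset (Fin (m + 1))).image fun σ => (e.succ, σ))).card ≤
      (Finset.univ.filter fun c : CIdx m n => v c ≠ 0).card := by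
    refine Finset.card_le_card fun c hc => ?_
    rw [Finset.mem_insert] at hc
    rw [Finset.mem_filter]
    rcases hc with rfl | hc
    · exact ⟨Finset.mem_univ _, hlast⟩
    · rw [Finset.mem_image] at hc
      obtain ⟨σ, -, rfl⟩ := hc
      exact ⟨Finset.mem_univ _, he σ⟩
  rw [Finset.card_insert_of_notMem h2, h1] at hle
  exact hle


/-! ### Generic facts about CSS stabilizer spans -/

section CSSGeneric

variable {N kX kZ : ℕ} (HX : Fin kX → Fin N → ZMod 2) (HZ : Fin kZ → Fin N → ZMod 2)

/-- **The symplectic dual of a CSS span**: `(p_X | p_Z)` commutes with every `X(h)`, `h` a row of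
`H_X`, and every `Z(h')`, `h'` a row of `H_Z`, iff `H_X p_Z = 0` and `H_Z p_X = 0`.
[cite: KapshikarKundu2023, §4.1 (CSS codes: S_X, S_Z)] -/
theorem mem_sympDual_cssRowSpan_iff (P : SympVec N) :
    P ∈ sympDual (cssRowSpan HX HZ) ↔ (∀ i, HX i ⬝ᵥ P.2 = 0) ∧ ∀ j, P.1 ⬝ᵥ HZ j = 0 := by
  rw [mem_sympDual_iff]
  constructor
  · intro h
    refine ⟨fun i => ?_, fun j => ?_⟩
    · have := h _ (xRow_mem_cssRowSpan HX HZ i)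
      simpa [sympInner] using this
    · have := h _ (zRow_mem_cssRowSpan HX HZ j)
      simpa [sympInner] using this
  · rintro ⟨hX, hZ⟩ v hv
    induction hv using Submodule.span_induction with
    | mem v hv =>
      rcases hv with ⟨i, rfl⟩ | ⟨j, rfl⟩
      · simp [sympInner, hX i]
      · simp [sympInner, hZ j]
    | zero => exact sympInner_zero_left P
    | add u v _ _ hu hv => rw [sympInner_add_left, hu, hv, add_zero]
    | smul a v _ hv => rw [sympInner_smul_left, hv, mul_zero]

/-- **A CSS span is self-orthogonal iff `H_X H_Zᵀ = 0`** (the direction used here).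
[cite: KapshikarKundu2023, §4.1 ("C₁ and C₂ are classical codes that are mutually orthogonal")] -/
theorem isSelfOrthogonal_cssRowSpan (h : ∀ i j, HX i ⬝ᵥ HZ j = 0) : IsSelfOrthogonal (cssRowSpan HX HZ) := by
  refine Submodule.span_le.2 ?_
  rintro v (⟨i, rfl⟩ | ⟨j, rfl⟩)
  · exact (mem_sympDual_cssRowSpan_iff HX HZ _).2 ⟨fun i' => by simp, fun j => h i j⟩
  · exact (mem_sympDual_cssRowSpan_iff HX HZ _).2 ⟨fun i => h i j, fun j' => by simp⟩

/-- An element of the CSS span has its X-part in the row space of `H_X` and its Z-part in the row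
space of `H_Z`. [cite: KapshikarKundu2023, §4.1 (S_X = {X(c) : c ∈ C₁}, S_Z = {Z(c) : c ∈ C₂})] -/
theorem mem_prod_of_mem_cssRowSpan {P : SympVec N} (hP : P ∈ cssRowSpan HX HZ) :
    P.1 ∈ Submodule.span (ZMod 2) (Set.range HX) ∧ P.2 ∈ Submodule.span (ZMod 2) (Set.range HZ) := by
  have hle : cssRowSpan HX HZ ≤ (Submodule.span (ZMod 2) (Set.range HX)).prod (Submodule.span (ZMod 2) (Set.range HZ)) := by
    refine Submodule.span_le.2 ?_
    rintro v (⟨i, rfl⟩ | ⟨j, rfl⟩)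
    · exact ⟨Submodule.subset_span ⟨i, rfl⟩, Submodule.zero_mem _⟩
    · exact ⟨Submodule.zero_mem _, Submodule.subset_span ⟨j, rfl⟩⟩
  exact (Submodule.mem_prod.1 (hle hP))

/-- Explicit combinations of the rows lie in the CSS span. [cite: KapshikarKundu2023, §4.1] -/
theorem sum_mem_cssRowSpan (a : Fin kX → ZMod 2) (b : Fin kZ → ZMod 2) {P : SympVec N}
    (h1 : P.1 = ∑ i, a i • HX i) (h2 : P.2 = ∑ j, b j • HZ j) : P ∈ cssRowSpan HX HZ := by
  have hP : P = (∑ i, a i • ((HX i, 0) : SympVec N)) + ∑ j, b j • ((0, HZ j) : SympVec N) := by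
    ext u
    · simp [h1, Prod.fst_sum, Finset.sum_apply]
    · simp [h2, Prod.snd_sum, Finset.sum_apply]
  rw [hP]
  refine Submodule.add_mem _ (Submodule.sum_mem _ fun i _ => Submodule.smul_mem _ _ (xRow_mem_cssRowSpan HX HZ i))
    (Submodule.sum_mem _ fun j _ => Submodule.smul_mem _ _ (zRow_mem_cssRowSpan HX HZ j))

/-- **A dual witness of non-membership**: a vector with an odd overlap with `z` but even overlap
with every row of `H` shows `z ∉ rowspace H`. [folklore] -/
private theorem dot_eq_zero_of_mem_span {k : ℕ} (H : Fin k → Fin N → ZMod 2) (u : Fin N → ZMod 2)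
    (hu : ∀ j, u ⬝ᵥ H j = 0) {v : Fin N → ZMod 2} (hv : v ∈ Submodule.span (ZMod 2) (Set.range H)) :
    u ⬝ᵥ v = 0 := by
  induction hv using Submodule.span_induction with
  | mem v hv => obtain ⟨j, rfl⟩ := hv; exact hu j
  | zero => exact dotProduct_zero u
  | add v v' _ _ hv hv' => rw [dotProduct_add, hv, hv', add_zero]
  | smul a v _ hv => rw [dotProduct_smul, hv, smul_zero]

/-- Hence `z ∉ rowspace H` once some such `u` has odd overlap with `z`. [folklore] -/
private theorem not_mem_span_of_dot {k : ℕ} (H : Fin k → Fin N → ZMod 2) (u z : Fin N → ZMod 2)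
    (hu : ∀ j, u ⬝ᵥ H j = 0) (hz : u ⬝ᵥ z ≠ 0) : z ∉ Submodule.span (ZMod 2) (Set.range H) :=
  fun hmem => hz (dot_eq_zero_of_mem_span H u hu hmem)

/-- The weight of `(p_X | p_Z)` is at least the Hamming weight of `p_X`. [cite: CalderbankEtAl1998, §2 (printed p. 4, weight of (a|b))] -/
theorem hammingNorm_fst_le_sympWeight (P : SympVec N) : hammingNorm P.1 ≤ sympWeight P := by
  unfold sympWeight hammingNorm
  exact Finset.card_le_card fun i hi => by
    simp only [Finset.mem_filter, Finset.mem_univ, true_and] at hi ⊢; exact Or.inl hi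

/-- The weight of `(p_X | p_Z)` is at least the Hamming weight of `p_Z`. [cite: CalderbankEtAl1998, §2 (printed p. 4, weight of (a|b))] -/
theorem hammingNorm_snd_le_sympWeight (P : SympVec N) : hammingNorm P.2 ≤ sympWeight P := by
  unfold sympWeight hammingNorm
  exact Finset.card_le_card fun i hi => by
    simp only [Finset.mem_filter, Finset.mem_univ, true_and] at hi ⊢; exact Or.inr hi

/-- The weight of a Z-type error `(0 | z)` is the Hamming weight of `z`. [cite: CalderbankEtAl1998, §2 (printed p. 4, weight of (a|b))] -/
theorem sympWeight_zero_left (z : Fin N → ZMod 2) : sympWeight (((0 : Fin N → ZMod 2), z) : SympVec N) = hammingNorm z := by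
  unfold sympWeight hammingNorm
  congr 1
  ext i
  simp

/-- Reindexing along an equivalence preserves the Hamming weight. [folklore] -/
private theorem hammingNorm_comp_equiv {α β : Type} [Fintype α] [Fintype β] [DecidableEq α] [DecidableEq β]
    (e : α ≃ β) (x : β → ZMod 2) : hammingNorm (x ∘ e) = hammingNorm x := by
  unfold hammingNorm
  exact Finset.card_equiv e fun i => by simp

end CSSGeneric

/-! ### The flat instance -/

/-- Number of qubits `(n+1)(m+1)(m+2)`. [construction of this file] [cite: KapshikarKundu2023, §4.1 Corollary 3 (statement)] -/
def nQ (m n : ℕ) : ℕ := (n + 1) * (m + 1) * (m + 2)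

/-- Qubits ↔ flat indices `u = ((a(m+1) + b)(m+2) + j`. [cite: AroraBarak2009, §0.1] -/
def eQ : QIdx m n ≃ Fin (nQ m n) := (Equiv.prodCongr finProdFinEquiv (Equiv.refl _)).trans finProdFinEquiv

/-- X-checks ↔ flat indices `f = e(m+1) + σ`. [cite: AroraBarak2009, §0.1] -/
def eX : XIdx m n ≃ Fin (n * (m + 1)) := finProdFinEquiv

/-- Z-checks ↔ flat indices: the `e_{(c,0)} + e_{(c,j)}` first (`r < nQ`), then the lifted
generators (`r = nQ + i`). [cite: AroraBarak2009, §0.1] -/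
def eZ : QIdx m n ⊕ Fin m ≃ Fin (nQ m n + m) := (Equiv.sumCongr eQ (Equiv.refl (Fin m))).trans finSumFinEquiv

/-- The Z-check vectors, by structured index. [construction of this file] [cite: KapshikarKundu2023, §4.1 Corollary 3 (statement)] -/
def zrow : QIdx m n ⊕ Fin m → QIdx m n → ZMod 2
  | Sum.inl q' => kvec q'
  | Sum.inr i => lift (gvec A y i.castSucc)

/-- **The X-check matrix** `H_X` (rows `r_ξ ⊗ 1_{m+2}`), flat. [construction of this file] [cite: KapshikarKundu2023, §4.1 Corollary 3 (statement)] -/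
def HXf (f : Fin (n * (m + 1))) (u : Fin (nQ m n)) : ZMod 2 := rvec A y (eX.symm f) (eQ.symm u).1

/-- **The Z-check matrix** `H_Z`, flat. [construction of this file] [cite: KapshikarKundu2023, §4.1 Corollary 3 (statement)] -/
def HZf (r : Fin (nQ m n + m)) (u : Fin (nQ m n)) : ZMod 2 := zrow A y (eZ.symm r) (eQ.symm u)

/-- **The CSS instance** `(⟨n(m+1), nQ + m, nQ, (H_X, H_Z)⟩, min(w, m) + 1)` of the COSET WEIGHTS
instance `(A, y, w)`. [construction of this file] [cite: KapshikarKundu2023, §4.1 Corollary 3 (statement)] -/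
def flatInst (m n : ℕ) (A : Fin m → Fin n → ZMod 2) (y : Fin n → ZMod 2) (w : ℕ) :
    (Σ mX : ℕ, Σ mZ : ℕ, Σ n' : ℕ, (Fin mX → Fin n' → ZMod 2) × (Fin mZ → Fin n' → ZMod 2)) × ℕ :=
  (⟨n * (m + 1), nQ m n + m, nQ m n, (HXf A y, HZf A y)⟩, min w m + 1)

/-! ### Flat ↔ structured dot products -/

/-- `H_X` rows against a flat Z-vector. [cite: AroraBarak2009, §0.1] -/
theorem HXf_dot (f : Fin (n * (m + 1))) (z : Fin (nQ m n) → ZMod 2) :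
    HXf A y f ⬝ᵥ z = rvec A y (eX.symm f) ⬝ᵥ proj (fun q => z (eQ q)) := by
  rw [← rep_dot, dotProduct, dotProduct, ← Equiv.sum_comp (eQ (m := m) (n := n))]
  simp [HXf, rep]

/-- A flat X-vector against `H_Z` rows. [cite: AroraBarak2009, §0.1] -/
theorem dot_HZf (x : Fin (nQ m n) → ZMod 2) (r : Fin (nQ m n + m)) :
    x ⬝ᵥ HZf A y r = (fun q => x (eQ q)) ⬝ᵥ zrow A y (eZ.symm r) := by
  rw [dotProduct, dotProduct, ← Equiv.sum_comp (eQ (m := m) (n := n))]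
  simp [HZf]

/-- Row `ξ` of `H_X`, flat. [cite: AroraBarak2009, §0.1] -/
theorem HXf_eX (ξ : XIdx m n) (u : Fin (nQ m n)) : HXf A y (eX ξ) u = rvec A y ξ (eQ.symm u).1 := by
  simp [HXf]

/-- Row `ζ` of `H_Z`, flat. [cite: AroraBarak2009, §0.1] -/
theorem HZf_eZ (ζ : QIdx m n ⊕ Fin m) (u : Fin (nQ m n)) : HZf A y (eZ ζ) u = zrow A y ζ (eQ.symm u) := by
  simp [HZf]

/-- **`H_X H_Zᵀ = 0`**: the checks commute. [construction of this file] [cite: KapshikarKundu2023, §4.1 Corollary 3 (statement)] -/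
theorem HXf_dot_HZf (f : Fin (n * (m + 1))) (r : Fin (nQ m n + m)) : HXf A y f ⬝ᵥ HZf A y r = 0 := by
  rw [HXf_dot]
  have : (fun q => HZf A y r (eQ q)) = zrow A y (eZ.symm r) := by
    funext q; simp [HZf]
  rw [this]
  cases eZ.symm r with
  | inl q' => simp [zrow]
  | inr i => simp [zrow, rvec_dot_gvec]

/-! ### The equivalence -/

/-- The indicator of the coset-selector coordinate `(0, m)`, used as a dual witness. [construction of this file] [cite: KapshikarKundu2023, §4.1 Corollary 3 (statement)] -/
def δlast (c : CIdx m n) : ZMod 2 := if c = (0, Fin.last m) then 1 else 0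

/-- `δ · v = v_{(0,m)}`. [folklore] -/
private theorem δlast_dotProduct (v : CIdx m n → ZMod 2) : δlast ⬝ᵥ v = v (0, Fin.last m) := by
  simp [dotProduct, δlast, ite_mul, Finset.sum_ite_eq']

/-- **The CSS instance is a YES instance of CSS-QMD iff `(A, y, w)` is a YES instance of COSET
WEIGHTS.** (⇒) an undetectable error of weight `≤ min(w,m) + 1`: if its Z-part has block sums with
coset selector `1`, they are `(x, 1, (xA + y) ⊗ 1)` and the weight bound forces `xA = y`,
`|x| ≤ w`; if the coset selector is `0` the Z-part is a stabilizer, so the X-part is a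
non-stabilizer `u ⊗ 1`, of weight `≥ m + 2` — too heavy. (⇐) `Z((x, 1 ; 0) ⊗ e₀)` is undetectable
(odd overlap with `e_{(0,m)} ⊗ 1`, which commutes with all Z-checks) of weight `|x| + 1`.
[construction of this file] [cite: KapshikarKundu2023, §4.1 Corollary 3 (statement)] -/
theorem flat_mem_iff (w : ℕ) :
    flatInst m n A y w ∈ cssMinimumDistanceSet ↔
      ((⟨m, n, (A, y)⟩ : Σ m : ℕ, Σ n : ℕ, (Fin m → Fin n → ZMod 2) × (Fin n → ZMod 2)), w) ∈ cosetWeightsSet := by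
  change (IsSelfOrthogonal (cssRowSpan (HXf A y) (HZf A y)) ∧
    ∃ P ∈ sympDual (cssRowSpan (HXf A y) (HZf A y)), P ∉ cssRowSpan (HXf A y) (HZf A y) ∧
      sympWeight P ≤ min w m + 1) ↔
    ∃ x : Fin m → ZMod 2, hammingNorm x ≤ w ∧ Matrix.vecMul x (Matrix.of A) = y
  have hvecMul : ∀ (x : Fin m → ZMod 2) (e : Fin n), Matrix.vecMul x (Matrix.of A) e = ∑ i, x i * A i e :=
    fun x e => rfl
  constructor
  · rintro ⟨-, P, hPd, hPS, hPw⟩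
    rw [mem_sympDual_cssRowSpan_iff] at hPd
    obtain ⟨hdX, hdZ⟩ := hPd
    set Xm : QIdx m n → ZMod 2 := fun q => P.1 (eQ q) with hXm
    set Zm : QIdx m n → ZMod 2 := fun q => P.2 (eQ q) with hZm
    have hD1 : ∀ ξ : XIdx m n, rvec A y ξ ⬝ᵥ proj Zm = 0 := fun ξ => by
      have := hdX (eX ξ)
      rw [HXf_dot] at this
      simpa [hZm] using this
    have hD2 : ∀ q', Xm ⬝ᵥ kvec q' = 0 := fun q' => by
      have := hdZ (eZ (Sum.inl q'))
      rw [dot_HZf] at this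
      simpa [zrow] using this
    have hD3 : ∀ i : Fin m, Xm ⬝ᵥ lift (gvec A y i.castSucc) = 0 := fun i => by
      have := hdZ (eZ (Sum.inr i))
      rw [dot_HZf] at this
      simpa [zrow] using this
    have hwX : hammingNorm Xm ≤ min w m + 1 := by
      rw [hXm, show (fun q => P.1 (eQ q)) = P.1 ∘ eQ from rfl, hammingNorm_comp_equiv]
      exact (hammingNorm_fst_le_sympWeight P).trans hPw
    have hwZ : hammingNorm Zm ≤ min w m + 1 := by
      rw [hZm, show (fun q => P.2 (eQ q)) = P.2 ∘ eQ from rfl, hammingNorm_comp_equiv]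
      exact (hammingNorm_snd_le_sympWeight P).trans hPw
    set v := proj Zm with hv
    by_cases hlast : v (0, Fin.last m) = 0
    · -- the Z-part is a stabilizer
      exfalso
      have hZspan : P.2 ∈ Submodule.span (ZMod 2) (Set.range (HZf A y)) := by
        have hP2 : P.2 = (∑ q' : QIdx m n, Zm q' • HZf A y (eZ (Sum.inl q'))) +
            ∑ i : Fin m, v (0, i.castSucc) • HZf A y (eZ (Sum.inr i)) := by
          funext u
          have h := eq_sum_zside A y hD1 hlast (eQ.symm u)
          simp only [Finset.sum_apply, Pi.add_apply, Pi.smul_apply, smul_eq_mul, HZf_eZ, zrow]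
          simpa [hZm] using h
        rw [hP2]
        exact Submodule.add_mem _
          (Submodule.sum_mem _ fun q' _ => Submodule.smul_mem _ _ (Submodule.subset_span ⟨_, rfl⟩))
          (Submodule.sum_mem _ fun i _ => Submodule.smul_mem _ _ (Submodule.subset_span ⟨_, rfl⟩))
      -- the X-part is constant on blocks
      set u : CIdx m n → ZMod 2 := fun c => Xm (c, 0) with hu
      have hXrep : Xm = rep u := eq_rep_of_dot_kvec hD2
      have hug : ∀ i : Fin m, u ⬝ᵥ gvec A y i.castSucc = 0 := fun i => by
        rw [hu, ← dot_lift]; exact hD3 i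
      by_cases hlam : u ⬝ᵥ gvec A y (Fin.last m) = 0
      · -- then the X-part is a stabilizer too
        have hall : ∀ b : Fin (m + 1), u ⬝ᵥ gvec A y b = 0 := fun b => by
          induction b using Fin.lastCases with
          | last => exact hlam
          | cast i => exact hug i
        have hXspan : P.1 ∈ Submodule.span (ZMod 2) (Set.range (HXf A y)) := by
          have hP1 : P.1 = ∑ ξ : XIdx m n, u (ξ.1.succ, ξ.2) • HXf A y (eX ξ) := by
            funext u'
            have h := eq_sum_rvec_of_dot_gvec A y hall (eQ.symm u').1
            have h' : P.1 u' = Xm (eQ.symm u') := by simp [hXm]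
            rw [h', hXrep]
            simp only [rep, Finset.sum_apply, Pi.smul_apply, smul_eq_mul, HXf_eX]
            exact h
          rw [hP1]
          exact Submodule.sum_mem _ fun ξ _ => Submodule.smul_mem _ _ (Submodule.subset_span ⟨_, rfl⟩)
        -- so `P` is a stabilizer: contradiction
        obtain ⟨a, ha⟩ := (Submodule.mem_span_range_iff_exists_fun (ZMod 2)).1 hXspan
        obtain ⟨b, hb⟩ := (Submodule.mem_span_range_iff_exists_fun (ZMod 2)).1 hZspan
        exact hPS (sum_mem_cssRowSpan (HXf A y) (HZf A y) a b ha.symm hb.symm)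
      · -- otherwise the X-part `u ⊗ 1` is too heavy
        have hune : ∃ c, u c ≠ 0 := by
          by_contra hno
          push Not at hno
          apply hlam
          have : u = 0 := funext hno
          rw [this, zero_dotProduct]
        obtain ⟨c, hc⟩ := hune
        have h1 := le_hammingNorm_rep (m := m) (n := n) hc
        rw [← hXrep] at h1
        have : min w m + 1 ≤ m + 1 := Nat.succ_le_succ (Nat.min_le_right _ _)
        omega
    · -- the Z-part carries a coset element `(x, 1, (xA + y) ⊗ 1)`
      have hlast1 : v (0, Fin.last m) = 1 := (zmod2_ne_zero_iff _).1 hlast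
      set x : Fin m → ZMod 2 := fun i => v (0, i.castSucc) with hx
      have hcol : ∀ (e : Fin n) (σ : Fin (m + 1)), v (e.succ, σ) = Matrix.vecMul x (Matrix.of A) e + y e := by
        intro e σ
        rw [eq_sum_gvec_of_rvec_dot A y hD1 (e.succ, σ), Fin.sum_univ_castSucc, hvecMul]
        simp only [gvec_succ, A'_castSucc, A'_last, hlast1, one_mul, hx]
      by_cases hxA : Matrix.vecMul x (Matrix.of A) = y
      · refine ⟨x, ?_, hxA⟩
        have h1 := hammingNorm_add_one_le (m := m) (n := n) (v := v) hlast
        have h2 := hammingNorm_proj_le Zm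
        rw [← hv] at h2
        have h3 : min w m ≤ w := Nat.min_le_left _ _
        change hammingNorm x + 1 ≤ hammingNorm v at h1
        omega
      · exfalso
        obtain ⟨e, he⟩ : ∃ e, Matrix.vecMul x (Matrix.of A) e ≠ y e := by
          by_contra hno; push Not at hno; exact hxA (funext hno)
        have hcolne : ∀ σ : Fin (m + 1), v (e.succ, σ) ≠ 0 := fun σ => by
          rw [hcol, Ne, zmod2_add_eq_zero_iff]; exact he
        have h1 := le_hammingNorm_of_column (v := v) hlast hcolne
        have h2 := hammingNorm_proj_le Zm
        rw [← hv] at h2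
        have : min w m + 1 ≤ m + 1 := Nat.succ_le_succ (Nat.min_le_right _ _)
        omega
  · rintro ⟨x, hxw, hxA⟩
    refine ⟨isSelfOrthogonal_cssRowSpan _ _ (HXf_dot_HZf A y), ?_⟩
    -- the witness `Z((x, 1 ; 0) ⊗ e₀)`
    set sv : CIdx m n → ZMod 2 := selVec (Fin.snoc x 1) with hsv
    set zf : Fin (nQ m n) → ZMod 2 := fun u => lift sv (eQ.symm u) with hzf
    have hzf' : (fun q => zf (eQ q)) = lift sv := by funext q; simp [hzf]
    refine ⟨((0 : Fin (nQ m n) → ZMod 2), zf), ?_, ?_, ?_⟩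
    · -- undetectable: commutes with every check
      rw [mem_sympDual_cssRowSpan_iff]
      refine ⟨fun f => ?_, fun j => zero_dotProduct _⟩
      rw [HXf_dot, hzf', proj_lift, rvec_dot]
      have h0 : sv ((eX.symm f).1.succ, (eX.symm f).2) = 0 := by simp [hsv, selVec, Fin.succ_ne_zero]
      rw [h0, add_zero, Fin.sum_univ_castSucc]
      simp only [hsv, selVec, A'_castSucc, A'_last, Fin.snoc_castSucc, Fin.snoc_last, mul_one, if_true]
      have := congr_fun hxA (eX.symm f).1
      rw [hvecMul] at this
      rw [← this, zmod2_add_eq_zero_iff]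
      exact Finset.sum_congr rfl fun i _ => by simp [mul_comm]
    · -- not a stabilizer: odd overlap with `δ ⊗ 1`, which is even on every Z-check
      intro hmem
      have h2 := (mem_prod_of_mem_cssRowSpan _ _ hmem).2
      refine not_mem_span_of_dot (HZf A y) (fun u => rep δlast (eQ.symm u)) zf (fun r => ?_) ?_ h2
      · rw [dot_HZf]
        have : (fun q => rep (m := m) (n := n) δlast (eQ.symm (eQ q))) = rep δlast := by funext q; simp
        rw [this]
        cases eZ.symm r with
        | inl q' => simp [zrow, rep_dot]
        | inr i =>
          simp only [zrow, rep_dot, proj_lift, δlast_dotProduct, gvec_zero]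
          rw [if_neg (Fin.castSucc_lt_last i).ne']
      · have : (fun u => rep (m := m) (n := n) δlast (eQ.symm u)) ⬝ᵥ zf = rep δlast ⬝ᵥ lift sv := by
          rw [dotProduct, dotProduct, ← Equiv.sum_comp (eQ (m := m) (n := n))]
          simp [hzf]
        rw [this, rep_dot, proj_lift, δlast_dotProduct]
        simp [hsv, selVec]
    · -- weight `|x| + 1 ≤ min(w, m) + 1`
      rw [sympWeight_zero_left]
      have h1 : hammingNorm zf = hammingNorm (lift sv) := by
        rw [← hzf', show (fun q => zf (eQ q)) = zf ∘ eQ from rfl, hammingNorm_comp_equiv]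
      rw [h1]
      refine (hammingNorm_lift_le sv).trans ((hammingNorm_selVec_snoc_le (n := n) x).trans ?_)
      have hxm : hammingNorm x ≤ m := (hammingNorm_le_card_fintype).trans (by rw [Fintype.card_fin])
      have := Nat.le_min.2 ⟨hxw, hxm⟩
      omega


/-! ### The instance written by the machine: Boolean entries on flat indices -/

section Entries

variable (Ab : ℕ → ℕ → Bool) (yb : ℕ → Bool)

/-- Bit `(b, e)` of `A' = (A; y)` from bit tables of `A` and `y` (row `m` is `y`). [construction of this file] [cite: BerlekampMcelieceVantilborg1978, §III.A (p. 385)] -/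
def A'bit (m : ℕ) (b e : ℕ) : Bool := if b = m then yb e else Ab b e

/-- **Entry `(f, u)` of `H_X`**: with `e = f / (m+1)`, `σ = f % (m+1)`, `c = u / (m+2)`,
`a = c / (m+1)`, `b = c % (m+1)`: `(a = 0 ∧ A'_{b,e}) ∨ (a = e + 1 ∧ b = σ)`.
[construction of this file] [cite: KapshikarKundu2023, §4.1 Corollary 3 (statement)] -/
def xEntry (m : ℕ) (f u : ℕ) : Bool :=
  (decide (u / (m + 2) / (m + 1) = 0) && A'bit Ab yb m (u / (m + 2) % (m + 1)) (f / (m + 1))) ||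
    (decide (u / (m + 2) / (m + 1) = f / (m + 1) + 1) && decide (u / (m + 2) % (m + 1) = f % (m + 1)))

/-- **Entry `(r, u)` of `H_Z`**: with `N = nQ`, `q = r / N`, `ρ = r % N`, `c = u / (m+2)`,
`j = u % (m+2)`: for `q = 0` the vector `e_{(c',0)} + e_{(c',j')}`, `c' = ρ / (m+2)`, `j' = ρ % (m+2)`;
otherwise the lifted generator `g_ρ ⊗ e₀`. [construction of this file] [cite: KapshikarKundu2023, §4.1 Corollary 3 (statement)] -/
def zEntry (m n : ℕ) (r u : ℕ) : Bool :=
  if r / nQ m n = 0 then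
    decide (u / (m + 2) = r % nQ m n / (m + 2)) &&
      xor (decide (u % (m + 2) = 0)) (decide (u % (m + 2) = r % nQ m n % (m + 2)))
  else
    decide (u % (m + 2) = 0) &&
      (decide (u / (m + 2) / (m + 1) = 0) && decide (u / (m + 2) % (m + 1) = r % nQ m n) ||
        (!decide (u / (m + 2) / (m + 1) = 0) && Ab (r % nQ m n) (u / (m + 2) / (m + 1) - 1)))

/-- The matrix `A` read off bit tables. [cite: BerlekampMcelieceVantilborg1978, §III.A (p. 385)] -/
def matOfBits (m n : ℕ) : Fin m → Fin n → ZMod 2 := fun i e => if Ab i e then 1 else 0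

/-- The vector `y` read off a bit table. [cite: BerlekampMcelieceVantilborg1978, §III.A (p. 385)] -/
def vecOfBits (n : ℕ) : Fin n → ZMod 2 := fun e => if yb e then 1 else 0

/-- Flat value of a qubit index: `u = (a(m+1) + b)(m+2) + j`. [cite: AroraBarak2009, §0.1] -/
theorem eQ_val (q : QIdx m n) :
    ((eQ q : Fin (nQ m n)) : ℕ) / (m + 2) / (m + 1) = q.1.1 ∧ ((eQ q : Fin (nQ m n)) : ℕ) / (m + 2) % (m + 1) = q.1.2 ∧
      ((eQ q : Fin (nQ m n)) : ℕ) % (m + 2) = q.2 ∧ ((eQ q : Fin (nQ m n)) : ℕ) / (m + 2) = (finProdFinEquiv q.1 : ℕ) := by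
  obtain ⟨⟨a, b⟩, j⟩ := q
  have hc : ((finProdFinEquiv (a, b) : Fin ((n + 1) * (m + 1))) : ℕ) = a * (m + 1) + b := by
    rw [finProdFinEquiv_apply_val]; ring
  have hu : ((eQ ((a, b), j) : Fin (nQ m n)) : ℕ) = (a * (m + 1) + b) * (m + 2) + j := by
    show ((finProdFinEquiv (finProdFinEquiv (a, b), j) : Fin ((n + 1) * (m + 1) * (m + 2))) : ℕ) = _
    rw [finProdFinEquiv_apply_val, hc]
    ring
  have h1 : ((a : ℕ) * (m + 1) + b) * (m + 2) + j = j + (m + 2) * (a * (m + 1) + b) := by ring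
  have hdiv : ((eQ ((a, b), j) : Fin (nQ m n)) : ℕ) / (m + 2) = a * (m + 1) + b := by
    rw [hu, h1, Nat.add_mul_div_left _ _ (by omega), Nat.div_eq_of_lt j.2, Nat.zero_add]
  have hmod : ((eQ ((a, b), j) : Fin (nQ m n)) : ℕ) % (m + 2) = j := by
    rw [hu, h1, Nat.add_mul_mod_self_left, Nat.mod_eq_of_lt j.2]
  refine ⟨?_, ?_, hmod, by rw [hdiv, hc]⟩
  · rw [hdiv, show (a : ℕ) * (m + 1) + b = b + (m + 1) * a by ring, Nat.add_mul_div_left _ _ (by omega),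
      Nat.div_eq_of_lt b.2, Nat.zero_add]
  · rw [hdiv, show (a : ℕ) * (m + 1) + b = b + (m + 1) * a by ring, Nat.add_mul_mod_self_left, Nat.mod_eq_of_lt b.2]

/-- Flat value of an X-check index: `f = e(m+1) + σ`. [cite: AroraBarak2009, §0.1] -/
theorem eX_val (ξ : XIdx m n) :
    ((eX ξ : Fin (n * (m + 1))) : ℕ) / (m + 1) = ξ.1 ∧ ((eX ξ : Fin (n * (m + 1))) : ℕ) % (m + 1) = ξ.2 := by
  obtain ⟨e, σ⟩ := ξ
  have h : ((eX (e, σ) : Fin (n * (m + 1))) : ℕ) = σ + (m + 1) * e := by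
    simp only [eX, finProdFinEquiv_apply_val]
  rw [h, Nat.add_mul_div_left _ _ (by omega), Nat.div_eq_of_lt σ.2, Nat.zero_add, Nat.add_mul_mod_self_left,
    Nat.mod_eq_of_lt σ.2]
  constructor <;> rfl

/-- `nQ > 0`. [folklore] -/
private theorem nQ_pos (m n : ℕ) : 0 < nQ m n := by unfold nQ; positivity

/-- `m < nQ`. [folklore] -/
private theorem lt_nQ (m n : ℕ) : m < nQ m n := by
  unfold nQ
  calc m < m + 2 := by omega
    _ ≤ (m + 1) * (m + 2) := Nat.le_mul_of_pos_left _ (by omega)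
    _ ≤ (n + 1) * ((m + 1) * (m + 2)) := Nat.le_mul_of_pos_left _ (by omega)
    _ = (n + 1) * (m + 1) * (m + 2) := by ring

/-- Flat value of a Z-check index of the first kind: `r = eQ q' < nQ`. [cite: AroraBarak2009, §0.1] -/
theorem eZ_inl_val (q' : QIdx m n) : ((eZ (Sum.inl q') : Fin (nQ m n + m)) : ℕ) = (eQ q' : ℕ) := by
  simp [eZ]

/-- Flat value of a Z-check index of the second kind: `r = nQ + i`. [cite: AroraBarak2009, §0.1] -/
theorem eZ_inr_val (i : Fin m) : ((eZ (m := m) (n := n) (Sum.inr i) : Fin (nQ m n + m)) : ℕ) = nQ m n + i := by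
  simp [eZ]

/-- `A'` by the numerical value of the row index. [construction of this file] [cite: BerlekampMcelieceVantilborg1978, §III.A (p. 385)] -/
theorem A'_eq_A'bit (b : Fin (m + 1)) (e : Fin n) :
    A' (matOfBits Ab m n) (vecOfBits yb n) b e = if A'bit Ab yb m b e then 1 else 0 := by
  induction b using Fin.lastCases with
  | last => simp [A'bit, vecOfBits]
  | cast i => simp [A'bit, matOfBits, Nat.ne_of_lt i.2]

/-- In `𝔽₂` the sum of two indicators is the indicator of the exclusive or. [folklore] -/
private theorem one_add_one_zmod2 : (1 : ZMod 2) + 1 = 0 := by decide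

/-- In `𝔽₂` the sum of two indicators is the indicator of the exclusive or. [folklore] -/
private theorem ite_add_ite (p q : Prop) [Decidable p] [Decidable q] :
    ((if p then (1 : ZMod 2) else 0) + if q then 1 else 0) = if xor (decide p) (decide q) then 1 else 0 := by
  by_cases hp : p <;> by_cases hq : q <;> simp [hp, hq, one_add_one_zmod2]

/-- **The machine's `H_X` entry is the entry of `r_ξ ⊗ 1`.** [construction of this file] [cite: KapshikarKundu2023, §4.1 Corollary 3 (statement)] -/
theorem xEntry_eq (ξ : XIdx m n) (q : QIdx m n) :
    (if xEntry Ab yb m (eX ξ) (eQ q) then (1 : ZMod 2) else 0) =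
      rvec (matOfBits Ab m n) (vecOfBits yb n) ξ q.1 := by
  obtain ⟨h1, h2, -, -⟩ := eQ_val q
  obtain ⟨h4, h5⟩ := eX_val ξ
  obtain ⟨⟨a, b⟩, j⟩ := q
  obtain ⟨e, σ⟩ := ξ
  simp only at h1 h2 h4 h5
  unfold xEntry
  rw [h1, h2, h4, h5]
  induction a using Fin.cases with
  | zero =>
    rw [rvec_zero, A'_eq_A'bit]
    have h0 : ((0 : Fin (n + 1)) : ℕ) = 0 := rfl
    have h0' : ((0 : ℕ) = (e : ℕ) + 1) = False := eq_false (by omega)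
    simp only [h0, h0', decide_true, decide_false, Bool.true_and, Bool.false_and, Bool.or_false]
  | succ a =>
    rw [rvec_succ]
    have h0 : (((a.succ : Fin (n + 1)) : ℕ) = 0) = False := eq_false (by simp [Fin.val_succ])
    have h1' : (((a.succ : Fin (n + 1)) : ℕ) = (e : ℕ) + 1) = (a = e) := by
      rw [Fin.val_succ]; exact propext ⟨fun h => Fin.ext (by omega), fun h => by rw [h]⟩
    have h2' : ((b : ℕ) = (σ : ℕ)) = (b = σ) := propext Fin.val_inj
    simp only [h0, h1', h2', decide_false, Bool.false_and, Bool.false_or]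
    by_cases hae : a = e <;> by_cases hbs : b = σ <;> simp [hae, hbs]

/-- Numerical value `0` of a `Fin` index. [folklore] -/
private theorem fin_val_eq_zero {k : ℕ} (j : Fin (k + 1)) : ((j : ℕ) = 0) ↔ j = 0 :=
  ⟨fun h => Fin.ext h, fun h => h ▸ rfl⟩

/-- **The machine's `H_Z` entry is the entry of the Z-check vector.** [construction of this file] [cite: KapshikarKundu2023, §4.1 Corollary 3 (statement)] -/
theorem zEntry_eq (ζ : QIdx m n ⊕ Fin m) (q : QIdx m n) :
    (if zEntry Ab m n (eZ ζ) (eQ q) then (1 : ZMod 2) else 0) =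
      zrow (matOfBits Ab m n) (vecOfBits yb n) ζ q := by
  obtain ⟨h1, h2, h3, h3'⟩ := eQ_val q
  obtain ⟨⟨a, b⟩, j⟩ := q
  simp only at h1 h2 h3 h3'
  cases ζ with
  | inl q' =>
    obtain ⟨-, -, h6, h6'⟩ := eQ_val q'
    obtain ⟨c', j'⟩ := q'
    simp only at h6 h6'
    have hq : ((eZ (Sum.inl (c', j')) : Fin (nQ m n + m)) : ℕ) / nQ m n = 0 := by
      rw [eZ_inl_val]; exact Nat.div_eq_of_lt (eQ (c', j')).2
    have hρ : ((eZ (Sum.inl (c', j')) : Fin (nQ m n + m)) : ℕ) % nQ m n = (eQ (c', j') : ℕ) := by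
      rw [eZ_inl_val]; exact Nat.mod_eq_of_lt (eQ (c', j')).2
    unfold zEntry
    rw [hq, if_pos rfl, hρ, h3, h3', h6, h6']
    simp only [zrow, kvec]
    by_cases hc : (a, b) = c'
    · subst hc
      simp only [if_true, decide_true, Bool.true_and, fin_val_eq_zero, Fin.val_inj]
      rw [ite_add_ite]
    · have hne : ((finProdFinEquiv (a, b) : Fin ((n + 1) * (m + 1))) : ℕ) ≠ (finProdFinEquiv c' : ℕ) := fun h =>
        hc (finProdFinEquiv.injective (Fin.ext h))
      have hF : (((finProdFinEquiv (a, b) : Fin ((n + 1) * (m + 1))) : ℕ) = (finProdFinEquiv c' : ℕ)) = False :=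
        eq_false hne
      simp only [hF, decide_false, Bool.false_and]
      rw [if_neg hc]
      simp
  | inr i =>
    have hval := eZ_inr_val (m := m) (n := n) i
    have hq : ((eZ (m := m) (n := n) (Sum.inr i) : Fin (nQ m n + m)) : ℕ) / nQ m n ≠ 0 := by
      rw [hval]; exact (Nat.div_pos (Nat.le_add_right _ _) (nQ_pos m n)).ne'
    have hρ : ((eZ (m := m) (n := n) (Sum.inr i) : Fin (nQ m n + m)) : ℕ) % nQ m n = i := by
      rw [hval, Nat.add_mod_left, Nat.mod_eq_of_lt (i.2.trans (lt_nQ m n))]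
    unfold zEntry
    rw [if_neg hq, hρ, h1, h2, h3]
    simp only [zrow, lift]
    by_cases hj : j = 0
    · subst hj
      simp only [Fin.val_zero, decide_true, Bool.true_and, if_true]
      induction a using Fin.cases with
      | zero =>
        rw [gvec_zero]
        simp [Fin.ext_iff]
      | succ a =>
        rw [gvec_succ, A'_castSucc]
        simp [matOfBits, Fin.val_succ]
    · have hj' : ((j : ℕ) = 0) = False := by rw [fin_val_eq_zero]; exact eq_false hj
      simp [hj, hj']

end Entries

/-! ### The machine's matrices are the flat matrices -/

section StringInstance

variable (Ab : ℕ → ℕ → Bool) (yb : ℕ → Bool)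

/-- `H_X` as written by the machine (bit tables, sizes `m, n`). [construction of this file] [cite: KapshikarKundu2023, §4.1 Corollary 3 (statement)] -/
def HXb (m n : ℕ) : Fin (n * (m + 1)) → Fin (nQ m n) → ZMod 2 := fun f u => if xEntry Ab yb m f u then 1 else 0

/-- `H_Z` as written by the machine. [construction of this file] [cite: KapshikarKundu2023, §4.1 Corollary 3 (statement)] -/
def HZb (m n : ℕ) : Fin (nQ m n + m) → Fin (nQ m n) → ZMod 2 := fun r u => if zEntry Ab m n r u then 1 else 0

/-- The machine's `H_X` is `H_X`. [construction of this file] [cite: KapshikarKundu2023, §4.1 Corollary 3 (statement)] -/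
theorem HXb_eq (m n : ℕ) : HXb Ab yb m n = HXf (matOfBits Ab m n) (vecOfBits yb n) := by
  funext f u
  obtain ⟨ξ, rfl⟩ := eX.surjective f
  obtain ⟨q, rfl⟩ := eQ.surjective u
  rw [HXb, xEntry_eq, HXf_eX, Equiv.symm_apply_apply]

/-- The machine's `H_Z` is `H_Z`. [construction of this file] [cite: KapshikarKundu2023, §4.1 Corollary 3 (statement)] -/
theorem HZb_eq (m n : ℕ) : HZb Ab m n = HZf (matOfBits Ab m n) (vecOfBits yb n) := by
  funext r u
  obtain ⟨ζ, rfl⟩ := eZ.surjective r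
  obtain ⟨q, rfl⟩ := eQ.surjective u
  rw [HZb, zEntry_eq Ab yb, HZf_eZ, Equiv.symm_apply_apply]

end StringInstance

/-- Bit `(b, e)` of the matrix rows of an instance string. [cite: AroraBarak2009, §0.1] -/
def Abits (x : List Bool) (b e : ℕ) : Bool := (CosetWeightsNP.item x b).getD e false

/-- Bit `e` of the target vector of an instance string. [cite: AroraBarak2009, §0.1] -/
def ybits (x : List Bool) (e : ℕ) : Bool := (CosetWeightsNP.yvOf x).getD e false

/-- **The CSS instance written from the string `x`** with size parameters `m, n` (the machine uses the
clamped sizes `(mhat x), (nhat x)`, equal to `m, n` on codes). [construction of this file] [cite: KapshikarKundu2023, §4.1 Corollary 3 (statement)] -/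
def strInst (x : List Bool) (m n : ℕ) :
    (Σ mX : ℕ, Σ mZ : ℕ, Σ n' : ℕ, (Fin mX → Fin n' → ZMod 2) × (Fin mZ → Fin n' → ZMod 2)) × ℕ :=
  (⟨n * (m + 1), nQ m n + m, nQ m n, (HXb (Abits x) (ybits x) m n, HZb (Abits x) m n)⟩, min (CosetWeightsNP.wOf x) m + 1)

/-- The string instance is the flat instance of the matrices read off the string. [construction of this file] [cite: KapshikarKundu2023, §4.1 Corollary 3 (statement)] -/
theorem strInst_eq (x : List Bool) (m n : ℕ) :
    strInst x m n = flatInst m n (matOfBits (Abits x) m n) (vecOfBits (ybits x) n) (CosetWeightsNP.wOf x) := by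
  unfold strInst flatInst
  rw [HXb_eq, HZb_eq (Abits x) (ybits x)]

/-- **On a code, the string instance is a YES instance of CSS-QMD iff the coded COSET WEIGHTS
instance is a YES instance.** [construction of this file] [cite: KapshikarKundu2023, §4.1 Corollary 3 (statement)] -/
theorem strInst_mem_iff (x : List Bool) :
    strInst x (CosetWeightsNP.mOf x) (CosetWeightsNP.nOf x) ∈ cssMinimumDistanceSet ↔
      CosetWeightsNP.instOf x ∈ cosetWeightsSet := by
  rw [strInst_eq, flat_mem_iff]
  rfl

/-! ### A fixed NO instance -/

/-- A fixed NO instance: no qubits, no checks (the dual of the zero space of `Ē₀` is itself). [folklore] -/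
def badI : (Σ mX : ℕ, Σ mZ : ℕ, Σ n' : ℕ, (Fin mX → Fin n' → ZMod 2) × (Fin mZ → Fin n' → ZMod 2)) × ℕ :=
  (⟨0, 0, 0, (fun _ _ => 0, fun _ _ => 0)⟩, 0)

/-- The NO instance is a no-instance. [folklore] -/
private theorem badI_not_mem : badI ∉ cssMinimumDistanceSet := by
  rintro ⟨-, w, -, hw, -⟩
  apply hw
  have : w = 0 := by
    ext i <;> exact Fin.elim0 i
  rw [this]
  exact Submodule.zero_mem _

/-! ### The machine: bricks -/

open Polynomial Brick HashBricks Plumb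
open Literature.InformationTheory.Coding.CosetWeightsNP (mhat nhat)

/-- `true :: 1ᵏ = 1ᵏ⁺¹`. [folklore] -/
private theorem true_cons_ones (k : ℕ) : true :: ones k = ones (k + 1) := rfl

/-- `1ᵃ = ε ↔ a = 0`. [folklore] -/
private theorem decide_ones_eq_nil (a : ℕ) : decide (ones a = []) = decide (a = 0) := by
  cases a <;> simp [ones, List.replicate_succ]

/-- `1ᵃ = 1ᵇ ↔ a = b`. [folklore] -/
private theorem decide_ones_eq_ones (a b : ℕ) : decide (ones a = ones b) = decide (a = b) :=
  decide_eq_decide.2 ⟨fun h => by simpa [ones] using congrArg List.length h, fun h => h ▸ rfl⟩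

/-- Value of `mhatF` (re-proved; private upstream). [folklore] -/
private theorem mhatF_apply (x : List Bool) : CosetWeightsNP.mhatF x = ones (CosetWeightsNP.mhat x) := by
  rw [CosetWeightsNP.mhatF, Function.comp_apply, fanoutFn_apply, binToUnaryFn_boolPair]; rfl

/-- Value of `nhatF` (re-proved; private upstream). [folklore] -/
private theorem nhatF_apply (x : List Bool) : CosetWeightsNP.nhatF x = ones (CosetWeightsNP.nhat x) := by
  rw [CosetWeightsNP.nhatF, Function.comp_apply, fanoutFn_apply, binToUnaryFn_boolPair]; rfl

/-- Value of `itemF` (re-proved; private upstream). [folklore] -/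
private theorem itemF_apply (x : List Bool) (t : ℕ) :
    CosetWeightsNP.itemF (boolPair x (ones t)) = CosetWeightsNP.item x t := by
  rw [CosetWeightsNP.itemF, Function.comp_apply, fanoutFn_apply, sndF_boolPair, Function.comp_apply, fstF_boolPair,
    nthItemFn_boolPair, List.length_replicate]; rfl

/-- On a good shape the clamps are off (re-proved; private upstream). [folklore] -/
private theorem clamps_of_goodShape {x : List Bool} (h : CosetWeightsNP.GoodShape x) :
    CosetWeightsNP.mhat x = CosetWeightsNP.mOf x ∧ CosetWeightsNP.nhat x = CosetWeightsNP.nOf x := by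
  obtain ⟨hx, hy, -⟩ := h
  have hlen := congrArg List.length hx
  simp only [CosetWeightsNP.reb, length_boolPair, List.length_replicate] at hlen
  unfold CosetWeightsNP.mhat CosetWeightsNP.nhat at *
  omega

/-! #### Size functions of the input `x` -/

/-- `1^{mhat + 1}`. [folklore] -/
def m1x : List Bool → List Bool := List.cons true ∘ CosetWeightsNP.mhatF
/-- `1^{mhat + 2}`. [folklore] -/
def m2x : List Bool → List Bool := List.cons true ∘ m1x
/-- `1^{nhat + 1}`. [folklore] -/
def n1x : List Bool → List Bool := List.cons true ∘ CosetWeightsNP.nhatF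
/-- `1^{nQ}`, `nQ = (nhat+1)(mhat+1)(mhat+2)`. [folklore] -/
def nQx : List Bool → List Bool := umulFn ∘ fanoutFn (umulFn ∘ fanoutFn n1x m1x) m2x
/-- `1^{mX}`, `mX = nhat (mhat+1)`. [folklore] -/
def mXx : List Bool → List Bool := umulFn ∘ fanoutFn CosetWeightsNP.nhatF m1x
/-- `1^{mZ}`, `mZ = nQ + mhat`. [folklore] -/
def mZx : List Bool → List Bool := fun z => nQx z ++ CosetWeightsNP.mhatF z
/-- `bin (min(w, mhat) + 1)`: the threshold. [construction of this file] [cite: KapshikarKundu2023, §4.1 Corollary 3 (statement)] -/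
def tauF : List Bool → List Bool := lenBinF ∘ List.cons true ∘ binToUnaryFn ∘ fanoutFn CosetWeightsNP.mhatF sndF

/-- `m1x ∈ FP`. [cite: AroraBarak2009, §1.3 (polynomial time is closed under composition and bounded loops)] -/
theorem m1x_mem_FP : m1x ∈ FP := comp_mem_FP (cons_mem_FP true) CosetWeightsNP.mhatF_mem_FP
/-- `m2x ∈ FP`. [cite: AroraBarak2009, §1.3 (polynomial time is closed under composition and bounded loops)] -/
theorem m2x_mem_FP : m2x ∈ FP := comp_mem_FP (cons_mem_FP true) m1x_mem_FP
/-- `n1x ∈ FP`. [cite: AroraBarak2009, §1.3 (polynomial time is closed under composition and bounded loops)] -/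
theorem n1x_mem_FP : n1x ∈ FP := comp_mem_FP (cons_mem_FP true) CosetWeightsNP.nhatF_mem_FP
/-- `nQx ∈ FP`. [cite: AroraBarak2009, §1.3 (polynomial time is closed under composition and bounded loops)] -/
theorem nQx_mem_FP : nQx ∈ FP :=
  comp_mem_FP umulFn_mem_FP (fanoutFn_mem_FP (comp_mem_FP umulFn_mem_FP (fanoutFn_mem_FP n1x_mem_FP m1x_mem_FP)) m2x_mem_FP)
/-- `mXx ∈ FP`. [cite: AroraBarak2009, §1.3 (polynomial time is closed under composition and bounded loops)] -/
theorem mXx_mem_FP : mXx ∈ FP := comp_mem_FP umulFn_mem_FP (fanoutFn_mem_FP CosetWeightsNP.nhatF_mem_FP m1x_mem_FP)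
/-- `mZx ∈ FP`. [cite: AroraBarak2009, §1.3 (polynomial time is closed under composition and bounded loops)] -/
theorem mZx_mem_FP : mZx ∈ FP := append_mem_FP nQx_mem_FP CosetWeightsNP.mhatF_mem_FP
/-- `tauF ∈ FP`. [cite: AroraBarak2009, §1.3 (polynomial time is closed under composition and bounded loops)] -/
theorem tauF_mem_FP : tauF ∈ FP :=
  comp_mem_FP lenBinF_mem_FP (comp_mem_FP (cons_mem_FP true) (comp_mem_FP binToUnaryFn_mem_FP
    (fanoutFn_mem_FP CosetWeightsNP.mhatF_mem_FP sndF_mem_FP)))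

section SizeValues

variable (x : List Bool)


/-- Value of `m1x`. [cite: AroraBarak2009, §1.3 (arithmetic on unary counters)] -/
theorem m1x_apply : m1x x = ones ((mhat x) + 1) := by
  rw [m1x, Function.comp_apply, mhatF_apply, true_cons_ones]
/-- Value of `m2x`. [cite: AroraBarak2009, §1.3 (arithmetic on unary counters)] -/
theorem m2x_apply : m2x x = ones ((mhat x) + 2) := by
  rw [m2x, Function.comp_apply, m1x_apply, true_cons_ones]
/-- Value of `n1x`. [cite: AroraBarak2009, §1.3 (arithmetic on unary counters)] -/
theorem n1x_apply : n1x x = ones ((nhat x) + 1) := by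
  rw [n1x, Function.comp_apply, nhatF_apply, true_cons_ones]
/-- Value of `nQx`. [cite: AroraBarak2009, §1.3 (arithmetic on unary counters)] -/
theorem nQx_apply : nQx x = ones (nQ (mhat x) (nhat x)) := by
  have h1 : (umulFn ∘ fanoutFn n1x m1x) x = ones (((nhat x) + 1) * ((mhat x) + 1)) := by
    rw [Function.comp_apply, fanoutFn_apply, n1x_apply, m1x_apply, umulFn_apply, fstF_boolPair, sndF_boolPair,
      List.length_replicate, List.length_replicate]
  rw [nQx, Function.comp_apply, fanoutFn_apply, h1, m2x_apply, umulFn_apply, fstF_boolPair, sndF_boolPair,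
    List.length_replicate, List.length_replicate]
  rfl
/-- Value of `mXx`. [cite: AroraBarak2009, §1.3 (arithmetic on unary counters)] -/
theorem mXx_apply : mXx x = ones ((nhat x) * ((mhat x) + 1)) := by
  rw [mXx, Function.comp_apply, fanoutFn_apply, nhatF_apply, m1x_apply, umulFn_apply, fstF_boolPair, sndF_boolPair,
    List.length_replicate, List.length_replicate]
/-- Value of `mZx`. [cite: AroraBarak2009, §1.3 (arithmetic on unary counters)] -/
theorem mZx_apply : mZx x = ones (nQ (mhat x) (nhat x) + (mhat x)) := by
  show nQx x ++ CosetWeightsNP.mhatF x = _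
  rw [nQx_apply, mhatF_apply, ones, ones, ones, List.replicate_add]
/-- Value of `tauF`. [cite: AroraBarak2009, §1.3 (arithmetic on unary counters)] -/
theorem tauF_apply : tauF x = encodeNat (min (CosetWeightsNP.wOf x) (mhat x) + 1) := by
  rw [tauF, Function.comp_apply, Function.comp_apply, Function.comp_apply, fanoutFn_apply, mhatF_apply,
    binToUnaryFn_boolPair, List.length_replicate, true_cons_ones, lenBinF_apply, List.length_replicate]
  rfl

end SizeValues

/-! #### Entry bricks (on the record `⟨⟨x, 1ᵗ⟩, 1ᵘ⟩`) -/

/-- On the entry record: the input `x`. [folklore] -/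
def zX : List Bool → List Bool := fstF ∘ fstF
/-- On the entry record: the row index `1ᵗ`. [folklore] -/
def zT : List Bool → List Bool := sndF ∘ fstF
/-- On the entry record: `1^{mhat}`. [folklore] -/
def mU : List Bool → List Bool := CosetWeightsNP.mhatF ∘ zX
/-- On the entry record: `1^{mhat+1}`. [folklore] -/
def m1U : List Bool → List Bool := m1x ∘ zX
/-- On the entry record: `1^{mhat+2}`. [folklore] -/
def m2U : List Bool → List Bool := m2x ∘ zX
/-- On the entry record: `⟨1^{t / (mhat+1)}, 1^{t % (mhat+1)}⟩` (X rows: `(e, σ)`). [folklore] -/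
def eσ : List Bool → List Bool := divModFn ∘ fanoutFn m1U zT
/-- On the entry record: `⟨1^{u / (mhat+2)}, 1^{u % (mhat+2)}⟩ = (c, j)`. [folklore] -/
def cj : List Bool → List Bool := divModFn ∘ fanoutFn m2U sndF
/-- On the entry record: `⟨1^{c / (mhat+1)}, 1^{c % (mhat+1)}⟩ = (a, b)`. [folklore] -/
def ab : List Bool → List Bool := divModFn ∘ fanoutFn m1U (fstF ∘ cj)
/-- On the entry record: `[a = 0]`. [folklore] -/
def a0 : List Bool → List Bool := eqPairFn ∘ fanoutFn (fstF ∘ ab) (fun _ => [])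
/-- On the entry record: `[b = mhat]`. [folklore] -/
def bm : List Bool → List Bool := eqPairFn ∘ fanoutFn (sndF ∘ ab) mU
/-- On the entry record: `[y_e]`. [folklore] -/
def ybitF : List Bool → List Bool := headBitFn ∘ bitAtFn ∘ fanoutFn (fstF ∘ eσ) (CosetWeightsNP.yvF ∘ zX)
/-- On the entry record: row `b` of the input matrix. [folklore] -/
def rowItF : List Bool → List Bool := CosetWeightsNP.itemF ∘ fanoutFn zX (sndF ∘ ab)
/-- On the entry record: `[A_{b,e}]`. [folklore] -/
def abitF : List Bool → List Bool := headBitFn ∘ bitAtFn ∘ fanoutFn (fstF ∘ eσ) rowItF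
/-- On the entry record: `[A'_{b,e}]`. [folklore] -/
def apbitF : List Bool → List Bool := iteFn bm ybitF abitF
/-- On the entry record: `[a = e + 1 ∧ b = σ]`. [folklore] -/
def hitF : List Bool → List Bool :=
  andFn (eqPairFn ∘ fanoutFn (fstF ∘ ab) (List.cons true ∘ fstF ∘ eσ)) (eqPairFn ∘ fanoutFn (sndF ∘ ab) (sndF ∘ eσ))
/-- **The `H_X` entry function.** [construction of this file] [cite: KapshikarKundu2023, §4.1 Corollary 3 (statement)] -/
def xbitF : List Bool → List Bool := orFn (andFn a0 apbitF) hitF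

/-- On the entry record: `1^{nQ}`. [folklore] -/
def nQU : List Bool → List Bool := nQx ∘ zX
/-- On the entry record: `⟨1^{t / nQ}, 1^{t % nQ}⟩ = (q, ρ)` (Z rows). [folklore] -/
def qρ : List Bool → List Bool := divModFn ∘ fanoutFn nQU zT
/-- On the entry record: `[q = 0]`. [folklore] -/
def q0 : List Bool → List Bool := eqPairFn ∘ fanoutFn (fstF ∘ qρ) (fun _ => [])
/-- On the entry record: `⟨1^{ρ / (mhat+2)}, 1^{ρ % (mhat+2)}⟩ = (c', j')`. [folklore] -/
def cjP : List Bool → List Bool := divModFn ∘ fanoutFn m2U (sndF ∘ qρ)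
/-- On the entry record: `[j = 0]`. [folklore] -/
def j0 : List Bool → List Bool := eqPairFn ∘ fanoutFn (sndF ∘ cj) (fun _ => [])
/-- On the entry record: `[c = c' ∧ ([j = 0] ⊕ [j = j'])]`. [folklore] -/
def kbitF : List Bool → List Bool :=
  andFn (eqPairFn ∘ fanoutFn (fstF ∘ cj) (fstF ∘ cjP)) (xorFn j0 (eqPairFn ∘ fanoutFn (sndF ∘ cj) (sndF ∘ cjP)))
/-- On the entry record: `[b = ρ]`. [folklore] -/
def selF : List Bool → List Bool := eqPairFn ∘ fanoutFn (sndF ∘ ab) (sndF ∘ qρ)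
/-- On the entry record: `1^{a - 1}`. [folklore] -/
def am1 : List Bool → List Bool := dropFn ∘ fanoutFn (fun _ => [true]) (fstF ∘ ab)
/-- On the entry record: row `ρ` of the input matrix. [folklore] -/
def gItF : List Bool → List Bool := CosetWeightsNP.itemF ∘ fanoutFn zX (sndF ∘ qρ)
/-- On the entry record: `[A_{ρ, a-1}]`. [folklore] -/
def gAbitF : List Bool → List Bool := headBitFn ∘ bitAtFn ∘ fanoutFn am1 gItF
/-- On the entry record: `[g_ρ(a, b)]`. [folklore] -/
def gbitF : List Bool → List Bool := orFn (andFn a0 selF) (andFn (notFn a0) gAbitF)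
/-- **The `H_Z` entry function.** [construction of this file] [cite: KapshikarKundu2023, §4.1 Corollary 3 (statement)] -/
def zbitF : List Bool → List Bool := iteFn q0 kbitF (andFn j0 gbitF)

/-! #### `FP` membership of the entry bricks -/

/-- `zX ∈ FP`. [cite: AroraBarak2009, §1.3 (polynomial time is closed under composition and bounded loops)] -/
theorem zX_mem_FP : zX ∈ FP := comp_mem_FP fstF_mem_FP fstF_mem_FP
/-- `zT ∈ FP`. [cite: AroraBarak2009, §1.3 (polynomial time is closed under composition and bounded loops)] -/
theorem zT_mem_FP : zT ∈ FP := comp_mem_FP sndF_mem_FP fstF_mem_FP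
/-- `mU ∈ FP`. [cite: AroraBarak2009, §1.3 (polynomial time is closed under composition and bounded loops)] -/
theorem mU_mem_FP : mU ∈ FP := comp_mem_FP CosetWeightsNP.mhatF_mem_FP zX_mem_FP
/-- `m1U ∈ FP`. [cite: AroraBarak2009, §1.3 (polynomial time is closed under composition and bounded loops)] -/
theorem m1U_mem_FP : m1U ∈ FP := comp_mem_FP m1x_mem_FP zX_mem_FP
/-- `m2U ∈ FP`. [cite: AroraBarak2009, §1.3 (polynomial time is closed under composition and bounded loops)] -/
theorem m2U_mem_FP : m2U ∈ FP := comp_mem_FP m2x_mem_FP zX_mem_FP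
/-- `eσ ∈ FP`. [cite: AroraBarak2009, §1.3 (polynomial time is closed under composition and bounded loops)] -/
theorem eσ_mem_FP : eσ ∈ FP := comp_mem_FP divModFn_mem_FP (fanoutFn_mem_FP m1U_mem_FP zT_mem_FP)
/-- `cj ∈ FP`. [cite: AroraBarak2009, §1.3 (polynomial time is closed under composition and bounded loops)] -/
theorem cj_mem_FP : cj ∈ FP := comp_mem_FP divModFn_mem_FP (fanoutFn_mem_FP m2U_mem_FP sndF_mem_FP)
/-- `ab ∈ FP`. [cite: AroraBarak2009, §1.3 (polynomial time is closed under composition and bounded loops)] -/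
theorem ab_mem_FP : ab ∈ FP := comp_mem_FP divModFn_mem_FP (fanoutFn_mem_FP m1U_mem_FP (comp_mem_FP fstF_mem_FP cj_mem_FP))
/-- `a0 ∈ FP`. [cite: AroraBarak2009, §1.3 (polynomial time is closed under composition and bounded loops)] -/
theorem a0_mem_FP : a0 ∈ FP :=
  comp_mem_FP eqPairFn_mem_FP (fanoutFn_mem_FP (comp_mem_FP fstF_mem_FP ab_mem_FP) (const_mem_FP _))
/-- `bm ∈ FP`. [cite: AroraBarak2009, §1.3 (polynomial time is closed under composition and bounded loops)] -/
theorem bm_mem_FP : bm ∈ FP := comp_mem_FP eqPairFn_mem_FP (fanoutFn_mem_FP (comp_mem_FP sndF_mem_FP ab_mem_FP) mU_mem_FP)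
/-- `ybitF ∈ FP`. [cite: AroraBarak2009, §1.3 (polynomial time is closed under composition and bounded loops)] -/
theorem ybitF_mem_FP : ybitF ∈ FP :=
  comp_mem_FP headBitFn_mem_FP (comp_mem_FP bitAtFn_mem_FP (fanoutFn_mem_FP (comp_mem_FP fstF_mem_FP eσ_mem_FP)
    (comp_mem_FP CosetWeightsNP.yvF_mem_FP zX_mem_FP)))
/-- `rowItF ∈ FP`. [cite: AroraBarak2009, §1.3 (polynomial time is closed under composition and bounded loops)] -/
theorem rowItF_mem_FP : rowItF ∈ FP :=
  comp_mem_FP CosetWeightsNP.itemF_mem_FP (fanoutFn_mem_FP zX_mem_FP (comp_mem_FP sndF_mem_FP ab_mem_FP))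
/-- `abitF ∈ FP`. [cite: AroraBarak2009, §1.3 (polynomial time is closed under composition and bounded loops)] -/
theorem abitF_mem_FP : abitF ∈ FP :=
  comp_mem_FP headBitFn_mem_FP (comp_mem_FP bitAtFn_mem_FP (fanoutFn_mem_FP (comp_mem_FP fstF_mem_FP eσ_mem_FP) rowItF_mem_FP))
/-- `apbitF ∈ FP`. [cite: AroraBarak2009, §1.3 (polynomial time is closed under composition and bounded loops)] -/
theorem apbitF_mem_FP : apbitF ∈ FP := iteFn_mem_FP bm_mem_FP ybitF_mem_FP abitF_mem_FP
/-- `hitF ∈ FP`. [cite: AroraBarak2009, §1.3 (polynomial time is closed under composition and bounded loops)] -/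
theorem hitF_mem_FP : hitF ∈ FP :=
  andFn_mem_FP (comp_mem_FP eqPairFn_mem_FP (fanoutFn_mem_FP (comp_mem_FP fstF_mem_FP ab_mem_FP)
      (comp_mem_FP (cons_mem_FP true) (comp_mem_FP fstF_mem_FP eσ_mem_FP))))
    (comp_mem_FP eqPairFn_mem_FP (fanoutFn_mem_FP (comp_mem_FP sndF_mem_FP ab_mem_FP) (comp_mem_FP sndF_mem_FP eσ_mem_FP)))
/-- **`xbitF ∈ FP`.** [cite: AroraBarak2009, §1.3 (polynomial time is closed under composition)] -/
theorem xbitF_mem_FP : xbitF ∈ FP := orFn_mem_FP (andFn_mem_FP a0_mem_FP apbitF_mem_FP) hitF_mem_FP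

/-- `nQU ∈ FP`. [cite: AroraBarak2009, §1.3 (polynomial time is closed under composition and bounded loops)] -/
theorem nQU_mem_FP : nQU ∈ FP := comp_mem_FP nQx_mem_FP zX_mem_FP
/-- `qρ ∈ FP`. [cite: AroraBarak2009, §1.3 (polynomial time is closed under composition and bounded loops)] -/
theorem qρ_mem_FP : qρ ∈ FP := comp_mem_FP divModFn_mem_FP (fanoutFn_mem_FP nQU_mem_FP zT_mem_FP)
/-- `q0 ∈ FP`. [cite: AroraBarak2009, §1.3 (polynomial time is closed under composition and bounded loops)] -/
theorem q0_mem_FP : q0 ∈ FP :=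
  comp_mem_FP eqPairFn_mem_FP (fanoutFn_mem_FP (comp_mem_FP fstF_mem_FP qρ_mem_FP) (const_mem_FP _))
/-- `cjP ∈ FP`. [cite: AroraBarak2009, §1.3 (polynomial time is closed under composition and bounded loops)] -/
theorem cjP_mem_FP : cjP ∈ FP := comp_mem_FP divModFn_mem_FP (fanoutFn_mem_FP m2U_mem_FP (comp_mem_FP sndF_mem_FP qρ_mem_FP))
/-- `j0 ∈ FP`. [cite: AroraBarak2009, §1.3 (polynomial time is closed under composition and bounded loops)] -/
theorem j0_mem_FP : j0 ∈ FP :=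
  comp_mem_FP eqPairFn_mem_FP (fanoutFn_mem_FP (comp_mem_FP sndF_mem_FP cj_mem_FP) (const_mem_FP _))
/-- `kbitF ∈ FP`. [cite: AroraBarak2009, §1.3 (polynomial time is closed under composition and bounded loops)] -/
theorem kbitF_mem_FP : kbitF ∈ FP :=
  andFn_mem_FP (comp_mem_FP eqPairFn_mem_FP (fanoutFn_mem_FP (comp_mem_FP fstF_mem_FP cj_mem_FP) (comp_mem_FP fstF_mem_FP cjP_mem_FP)))
    (xorFn_mem_FP j0_mem_FP (comp_mem_FP eqPairFn_mem_FP (fanoutFn_mem_FP (comp_mem_FP sndF_mem_FP cj_mem_FP)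
      (comp_mem_FP sndF_mem_FP cjP_mem_FP))))
/-- `selF ∈ FP`. [cite: AroraBarak2009, §1.3 (polynomial time is closed under composition and bounded loops)] -/
theorem selF_mem_FP : selF ∈ FP :=
  comp_mem_FP eqPairFn_mem_FP (fanoutFn_mem_FP (comp_mem_FP sndF_mem_FP ab_mem_FP) (comp_mem_FP sndF_mem_FP qρ_mem_FP))
/-- `am1 ∈ FP`. [cite: AroraBarak2009, §1.3 (polynomial time is closed under composition and bounded loops)] -/
theorem am1_mem_FP : am1 ∈ FP := comp_mem_FP dropFn_mem_FP (fanoutFn_mem_FP (const_mem_FP _) (comp_mem_FP fstF_mem_FP ab_mem_FP))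
/-- `gItF ∈ FP`. [cite: AroraBarak2009, §1.3 (polynomial time is closed under composition and bounded loops)] -/
theorem gItF_mem_FP : gItF ∈ FP :=
  comp_mem_FP CosetWeightsNP.itemF_mem_FP (fanoutFn_mem_FP zX_mem_FP (comp_mem_FP sndF_mem_FP qρ_mem_FP))
/-- `gAbitF ∈ FP`. [cite: AroraBarak2009, §1.3 (polynomial time is closed under composition and bounded loops)] -/
theorem gAbitF_mem_FP : gAbitF ∈ FP :=
  comp_mem_FP headBitFn_mem_FP (comp_mem_FP bitAtFn_mem_FP (fanoutFn_mem_FP am1_mem_FP gItF_mem_FP))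
/-- `gbitF ∈ FP`. [cite: AroraBarak2009, §1.3 (polynomial time is closed under composition and bounded loops)] -/
theorem gbitF_mem_FP : gbitF ∈ FP :=
  orFn_mem_FP (andFn_mem_FP a0_mem_FP selF_mem_FP) (andFn_mem_FP (notFn_mem_FP a0_mem_FP) gAbitF_mem_FP)
/-- **`zbitF ∈ FP`.** [cite: AroraBarak2009, §1.3 (polynomial time is closed under composition)] -/
theorem zbitF_mem_FP : zbitF ∈ FP := iteFn_mem_FP q0_mem_FP kbitF_mem_FP (andFn_mem_FP j0_mem_FP gbitF_mem_FP)

/-! #### One-bit-ness -/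

/-- `apbitF` is one-bit. [cite: AroraBarak2009, §1.3 (polynomial time is closed under composition and bounded loops)] -/
theorem oneBit_apbitF : OneBit apbitF := (oneBit_eqPairFn.comp _).ite (oneBit_headBitFn.comp _) (oneBit_headBitFn.comp _)
/-- `hitF` is one-bit. [cite: AroraBarak2009, §1.3 (polynomial time is closed under composition and bounded loops)] -/
theorem oneBit_hitF : OneBit hitF := oneBit_andFn (oneBit_eqPairFn.comp _) (oneBit_eqPairFn.comp _)
/-- `xbitF` is one-bit. [cite: AroraBarak2009, §1.3 (polynomial time is closed under composition and bounded loops)] -/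
theorem oneBit_xbitF : OneBit xbitF := oneBit_orFn (oneBit_andFn (oneBit_eqPairFn.comp _) oneBit_apbitF) oneBit_hitF
/-- `kbitF` is one-bit. [cite: AroraBarak2009, §1.3 (polynomial time is closed under composition and bounded loops)] -/
theorem oneBit_kbitF : OneBit kbitF :=
  oneBit_andFn (oneBit_eqPairFn.comp _) (oneBit_xorFn (oneBit_eqPairFn.comp _) (oneBit_eqPairFn.comp _))
/-- `gbitF` is one-bit. [cite: AroraBarak2009, §1.3 (polynomial time is closed under composition and bounded loops)] -/
theorem oneBit_gbitF : OneBit gbitF :=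
  oneBit_orFn (oneBit_andFn (oneBit_eqPairFn.comp _) (oneBit_eqPairFn.comp _))
    (oneBit_andFn (oneBit_notFn (oneBit_eqPairFn.comp _)) (oneBit_headBitFn.comp _))
/-- `zbitF` is one-bit. [cite: AroraBarak2009, §1.3 (polynomial time is closed under composition and bounded loops)] -/
theorem oneBit_zbitF : OneBit zbitF :=
  (oneBit_eqPairFn.comp _).ite oneBit_kbitF (oneBit_andFn (oneBit_eqPairFn.comp _) oneBit_gbitF)

/-! #### Values of the entry bricks -/

section EntryValues

variable (x : List Bool) (t u : ℕ)

/-- The entry record of row `t`, column `u`. [folklore] -/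
def rec (x : List Bool) (t u : ℕ) : List Bool := boolPair (boolPair x (ones t)) (ones u)


/-- Value of `zX`. [folklore] -/
private theorem zX_rec : zX (rec x t u) = x := by simp [zX, rec]
/-- Value of `zT`. [folklore] -/
private theorem zT_rec : zT (rec x t u) = ones t := by simp [zT, rec]
/-- Value of `sndF`. [folklore] -/
private theorem sndF_rec : sndF (rec x t u) = ones u := by simp [rec]
/-- Value of `mU`. [folklore] -/
private theorem mU_rec : mU (rec x t u) = ones (mhat x) := by rw [mU, Function.comp_apply, zX_rec, mhatF_apply]
/-- Value of `m1U`. [folklore] -/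
private theorem m1U_rec : m1U (rec x t u) = ones ((mhat x) + 1) := by rw [m1U, Function.comp_apply, zX_rec, m1x_apply]
/-- Value of `m2U`. [folklore] -/
private theorem m2U_rec : m2U (rec x t u) = ones ((mhat x) + 2) := by rw [m2U, Function.comp_apply, zX_rec, m2x_apply]
/-- Value of `eσ`. [folklore] -/
private theorem eσ_rec : eσ (rec x t u) = boolPair (ones (t / ((mhat x) + 1))) (ones (t % ((mhat x) + 1))) := by
  rw [eσ, Function.comp_apply, fanoutFn_apply, m1U_rec, zT_rec, divModFn_boolPair]
/-- Value of `cj`. [folklore] -/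
private theorem cj_rec : cj (rec x t u) = boolPair (ones (u / ((mhat x) + 2))) (ones (u % ((mhat x) + 2))) := by
  rw [cj, Function.comp_apply, fanoutFn_apply, m2U_rec, sndF_rec, divModFn_boolPair]
/-- Value of `ab`. [folklore] -/
private theorem ab_rec : ab (rec x t u) = boolPair (ones (u / ((mhat x) + 2) / ((mhat x) + 1))) (ones (u / ((mhat x) + 2) % ((mhat x) + 1))) := by
  rw [ab, Function.comp_apply, fanoutFn_apply, m1U_rec, Function.comp_apply, cj_rec, fstF_boolPair, divModFn_boolPair]
/-- Value of `a0`. [folklore] -/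
private theorem a0_rec : a0 (rec x t u) = [decide (u / ((mhat x) + 2) / ((mhat x) + 1) = 0)] := by
  rw [a0, Function.comp_apply, fanoutFn_apply, Function.comp_apply, ab_rec, fstF_boolPair, eqPairFn_boolPair,
    decide_ones_eq_nil]
/-- Value of `bm`. [folklore] -/
private theorem bm_rec : bm (rec x t u) = [decide (u / ((mhat x) + 2) % ((mhat x) + 1) = (mhat x))] := by
  rw [bm, Function.comp_apply, fanoutFn_apply, Function.comp_apply, ab_rec, sndF_boolPair, mU_rec, eqPairFn_boolPair,
    decide_ones_eq_ones]
/-- Value of `ybitF`. [folklore] -/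
private theorem ybitF_rec : ybitF (rec x t u) = [ybits x (t / ((mhat x) + 1))] := by
  rw [ybitF, Function.comp_apply, Function.comp_apply, fanoutFn_apply, Function.comp_apply, eσ_rec, fstF_boolPair,
    Function.comp_apply, zX_rec, bitAtFn_boolPair, List.length_replicate, headBitFn_apply, ThreeDMNP.headD_take_drop]
  rfl
/-- Value of `rowItF`. [folklore] -/
private theorem rowItF_rec : rowItF (rec x t u) = CosetWeightsNP.item x (u / ((mhat x) + 2) % ((mhat x) + 1)) := by
  rw [rowItF, Function.comp_apply, fanoutFn_apply, zX_rec, Function.comp_apply, ab_rec, sndF_boolPair, itemF_apply]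
/-- Value of `abitF`. [folklore] -/
private theorem abitF_rec : abitF (rec x t u) = [Abits x (u / ((mhat x) + 2) % ((mhat x) + 1)) (t / ((mhat x) + 1))] := by
  rw [abitF, Function.comp_apply, Function.comp_apply, fanoutFn_apply, Function.comp_apply, eσ_rec, fstF_boolPair,
    rowItF_rec, bitAtFn_boolPair, List.length_replicate, headBitFn_apply, ThreeDMNP.headD_take_drop]
  rfl
/-- Value of `apbitF`. [folklore] -/
private theorem apbitF_rec : apbitF (rec x t u) = [A'bit (Abits x) (ybits x) (mhat x) (u / ((mhat x) + 2) % ((mhat x) + 1)) (t / ((mhat x) + 1))] := by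
  rw [apbitF, iteFn_apply (bm_rec x t u), ybitF_rec, abitF_rec, A'bit]
  by_cases h : u / ((mhat x) + 2) % ((mhat x) + 1) = (mhat x) <;> simp [h]
/-- Value of `hitF`. [folklore] -/
private theorem hitF_rec :
    hitF (rec x t u) = [decide (u / ((mhat x) + 2) / ((mhat x) + 1) = t / ((mhat x) + 1) + 1) && decide (u / ((mhat x) + 2) % ((mhat x) + 1) = t % ((mhat x) + 1))] := by
  have h1 : (eqPairFn ∘ fanoutFn (fstF ∘ ab) (List.cons true ∘ fstF ∘ eσ)) (rec x t u) =
      [decide (u / ((mhat x) + 2) / ((mhat x) + 1) = t / ((mhat x) + 1) + 1)] := by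
    rw [Function.comp_apply, fanoutFn_apply, Function.comp_apply, ab_rec, fstF_boolPair, Function.comp_apply,
      Function.comp_apply, eσ_rec, fstF_boolPair, true_cons_ones, eqPairFn_boolPair, decide_ones_eq_ones]
  have h2 : (eqPairFn ∘ fanoutFn (sndF ∘ ab) (sndF ∘ eσ)) (rec x t u) = [decide (u / ((mhat x) + 2) % ((mhat x) + 1) = t % ((mhat x) + 1))] := by
    rw [Function.comp_apply, fanoutFn_apply, Function.comp_apply, ab_rec, sndF_boolPair, Function.comp_apply, eσ_rec,
      sndF_boolPair, eqPairFn_boolPair, decide_ones_eq_ones]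
  rw [hitF, andFn_apply h1 h2]

/-- **Value of the `H_X` entry function.** [construction of this file] [cite: KapshikarKundu2023, §4.1 Corollary 3 (statement)] -/
theorem xbitF_rec : xbitF (rec x t u) = [xEntry (Abits x) (ybits x) (mhat x) t u] := by
  rw [xbitF, orFn_apply (andFn_apply (a0_rec x t u) (apbitF_rec x t u)) (hitF_rec x t u), xEntry]

/-- Value of `nQU`. [folklore] -/
private theorem nQU_rec : nQU (rec x t u) = ones (nQ (mhat x) (nhat x)) := by rw [nQU, Function.comp_apply, zX_rec, nQx_apply]
/-- Value of `qρ`. [folklore] -/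
private theorem qρ_rec : qρ (rec x t u) = boolPair (ones (t / nQ (mhat x) (nhat x))) (ones (t % nQ (mhat x) (nhat x))) := by
  rw [qρ, Function.comp_apply, fanoutFn_apply, nQU_rec, zT_rec, divModFn_boolPair]
/-- Value of `q0`. [folklore] -/
private theorem q0_rec : q0 (rec x t u) = [decide (t / nQ (mhat x) (nhat x) = 0)] := by
  rw [q0, Function.comp_apply, fanoutFn_apply, Function.comp_apply, qρ_rec, fstF_boolPair, eqPairFn_boolPair,
    decide_ones_eq_nil]
/-- Value of `cjP`. [folklore] -/
private theorem cjP_rec : cjP (rec x t u) = boolPair (ones (t % nQ (mhat x) (nhat x) / ((mhat x) + 2))) (ones (t % nQ (mhat x) (nhat x) % ((mhat x) + 2))) := by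
  rw [cjP, Function.comp_apply, fanoutFn_apply, m2U_rec, Function.comp_apply, qρ_rec, sndF_boolPair, divModFn_boolPair]
/-- Value of `j0`. [folklore] -/
private theorem j0_rec : j0 (rec x t u) = [decide (u % ((mhat x) + 2) = 0)] := by
  rw [j0, Function.comp_apply, fanoutFn_apply, Function.comp_apply, cj_rec, sndF_boolPair, eqPairFn_boolPair,
    decide_ones_eq_nil]
/-- Value of `kbitF`. [folklore] -/
private theorem kbitF_rec : kbitF (rec x t u) =
    [decide (u / ((mhat x) + 2) = t % nQ (mhat x) (nhat x) / ((mhat x) + 2)) &&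
      xor (decide (u % ((mhat x) + 2) = 0)) (decide (u % ((mhat x) + 2) = t % nQ (mhat x) (nhat x) % ((mhat x) + 2)))] := by
  have h1 : (eqPairFn ∘ fanoutFn (fstF ∘ cj) (fstF ∘ cjP)) (rec x t u) = [decide (u / ((mhat x) + 2) = t % nQ (mhat x) (nhat x) / ((mhat x) + 2))] := by
    rw [Function.comp_apply, fanoutFn_apply, Function.comp_apply, cj_rec, fstF_boolPair, Function.comp_apply, cjP_rec,
      fstF_boolPair, eqPairFn_boolPair, decide_ones_eq_ones]
  have h2 : (eqPairFn ∘ fanoutFn (sndF ∘ cj) (sndF ∘ cjP)) (rec x t u) =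
      [decide (u % ((mhat x) + 2) = t % nQ (mhat x) (nhat x) % ((mhat x) + 2))] := by
    rw [Function.comp_apply, fanoutFn_apply, Function.comp_apply, cj_rec, sndF_boolPair, Function.comp_apply, cjP_rec,
      sndF_boolPair, eqPairFn_boolPair, decide_ones_eq_ones]
  rw [kbitF, andFn_apply h1 (xorFn_apply (j0_rec x t u) h2)]
/-- Value of `selF`. [folklore] -/
private theorem selF_rec : selF (rec x t u) = [decide (u / ((mhat x) + 2) % ((mhat x) + 1) = t % nQ (mhat x) (nhat x))] := by
  rw [selF, Function.comp_apply, fanoutFn_apply, Function.comp_apply, ab_rec, sndF_boolPair, Function.comp_apply, qρ_rec,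
    sndF_boolPair, eqPairFn_boolPair, decide_ones_eq_ones]
/-- Value of `am1`. [folklore] -/
private theorem am1_rec : am1 (rec x t u) = ones (u / ((mhat x) + 2) / ((mhat x) + 1) - 1) := by
  rw [am1, Function.comp_apply, fanoutFn_apply, Function.comp_apply, ab_rec, fstF_boolPair, dropFn_boolPair,
    List.length_singleton, ones, ones, List.drop_replicate]
/-- Value of `gItF`. [folklore] -/
private theorem gItF_rec : gItF (rec x t u) = CosetWeightsNP.item x (t % nQ (mhat x) (nhat x)) := by
  rw [gItF, Function.comp_apply, fanoutFn_apply, zX_rec, Function.comp_apply, qρ_rec, sndF_boolPair, itemF_apply]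
/-- Value of `gAbitF`. [folklore] -/
private theorem gAbitF_rec : gAbitF (rec x t u) = [Abits x (t % nQ (mhat x) (nhat x)) (u / ((mhat x) + 2) / ((mhat x) + 1) - 1)] := by
  rw [gAbitF, Function.comp_apply, Function.comp_apply, fanoutFn_apply, am1_rec, gItF_rec, bitAtFn_boolPair,
    List.length_replicate, headBitFn_apply, ThreeDMNP.headD_take_drop]
  rfl
/-- Value of `gbitF`. [folklore] -/
private theorem gbitF_rec : gbitF (rec x t u) =
    [decide (u / ((mhat x) + 2) / ((mhat x) + 1) = 0) && decide (u / ((mhat x) + 2) % ((mhat x) + 1) = t % nQ (mhat x) (nhat x)) ||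
      (!decide (u / ((mhat x) + 2) / ((mhat x) + 1) = 0) && Abits x (t % nQ (mhat x) (nhat x)) (u / ((mhat x) + 2) / ((mhat x) + 1) - 1))] := by
  rw [gbitF, orFn_apply (andFn_apply (a0_rec x t u) (selF_rec x t u))
    (andFn_apply (notFn_apply (a0_rec x t u)) (gAbitF_rec x t u))]

/-- **Value of the `H_Z` entry function.** [construction of this file] [cite: KapshikarKundu2023, §4.1 Corollary 3 (statement)] -/
theorem zbitF_rec : zbitF (rec x t u) = [zEntry (Abits x) (mhat x) (nhat x) t u] := by
  rw [zbitF, iteFn_apply (q0_rec x t u), kbitF_rec, andFn_apply (j0_rec x t u) (gbitF_rec x t u), zEntry]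
  by_cases h : t / nQ (mhat x) (nhat x) = 0 <;> simp [h]

end EntryValues

/-! ### The machine: rows, matrices, the instance -/

/-- The cubic clip/count polynomial `(X+2)³`. [cite: AroraBarak2009, §1.3 (bounded loops)] -/
def P3 : Polynomial ℕ := (X + 2) * (X + 2) * (X + 2)

/-- Value of `P3`. [folklore] -/
private theorem eval_P3 (L : ℕ) : P3.eval L = (L + 2) * (L + 2) * (L + 2) := by
  simp [P3, eval_mul, eval_add, eval_X]

/-- The clamped sizes are within the input length: `nQ ≤ (L+2)³` whenever `|x| ≤ L`. [folklore] -/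
private theorem nQ_hat_le (x : List Bool) {L : ℕ} (hL : x.length ≤ L) :
    nQ (CosetWeightsNP.mhat x) (CosetWeightsNP.nhat x) ≤ (L + 2) * (L + 2) * (L + 2) := by
  have hm : CosetWeightsNP.mhat x ≤ x.length := Nat.min_le_right _ _
  have hn : CosetWeightsNP.nhat x ≤ x.length := Nat.min_le_right _ _
  unfold nQ
  exact Nat.mul_le_mul (Nat.mul_le_mul (by omega) (by omega)) (by omega)

/-- `mX = nhat (mhat + 1) ≤ (L+2)³`. [folklore] -/
private theorem mX_hat_le (x : List Bool) {L : ℕ} (hL : x.length ≤ L) :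
    CosetWeightsNP.nhat x * (CosetWeightsNP.mhat x + 1) ≤ (L + 2) * (L + 2) * (L + 2) := by
  have hm : CosetWeightsNP.mhat x ≤ x.length := Nat.min_le_right _ _
  have hn : CosetWeightsNP.nhat x ≤ x.length := Nat.min_le_right _ _
  exact (Nat.mul_le_mul (by omega : CosetWeightsNP.nhat x ≤ L + 2) (by omega : CosetWeightsNP.mhat x + 1 ≤ L + 2)).trans
    (Nat.le_mul_of_pos_right _ (by omega))

/-- Row `t` of the machine's `H_X` as a bit string (any `t : ℕ`). [construction of this file] [cite: KapshikarKundu2023, §4.1 Corollary 3 (statement)] -/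
def xRowBits (x : List Bool) (t : ℕ) : List Bool :=
  List.ofFn fun u : Fin (nQ (CosetWeightsNP.mhat x) (CosetWeightsNP.nhat x)) =>
    xEntry (Abits x) (ybits x) (CosetWeightsNP.mhat x) t u

/-- Row `t` of the machine's `H_Z` as a bit string. [construction of this file] [cite: KapshikarKundu2023, §4.1 Corollary 3 (statement)] -/
def zRowBits (x : List Bool) (t : ℕ) : List Bool :=
  List.ofFn fun u : Fin (nQ (CosetWeightsNP.mhat x) (CosetWeightsNP.nhat x)) =>
    zEntry (Abits x) (CosetWeightsNP.mhat x) (CosetWeightsNP.nhat x) t u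

/-- **Row `t` of `H_X`**: the concatenation fold of `xbitF` over `u < nQ`, on `⟨x, 1ᵗ⟩`. [cite: AroraBarak2009, §1.3 (bounded loops)] -/
def xRowF : List Bool → List Bool := foldCat 1 P3 xbitF ∘ fanoutFn id (nQx ∘ fstF)
/-- **Row `t` of `H_Z`**. [cite: AroraBarak2009, §1.3 (bounded loops)] -/
def zRowF : List Bool → List Bool := foldCat 1 P3 zbitF ∘ fanoutFn id (nQx ∘ fstF)
/-- The framed row `⟨row t, ε⟩` of `H_X`. [cite: AroraBarak2009, §0.1] -/
def xFrameF : List Bool → List Bool := fanoutFn xRowF (fun _ => [])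
/-- The framed row of `H_Z`. [cite: AroraBarak2009, §0.1] -/
def zFrameF : List Bool → List Bool := fanoutFn zRowF (fun _ => [])
/-- **The rows of `H_X`**: fold of the framed rows over `t < mX`. [cite: AroraBarak2009, §1.3 (bounded loops)] -/
def xRowsF : List Bool → List Bool := foldCat (2 * P3 + 2) P3 xFrameF ∘ fanoutFn id mXx
/-- **The rows of `H_Z`**: fold over `t < mZ`. [cite: AroraBarak2009, §1.3 (bounded loops)] -/
def zRowsF : List Bool → List Bool := foldCat (2 * P3 + 2) (P3 + X) zFrameF ∘ fanoutFn id mZx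
/-- The matrix code `⟨1^{mX}, rows⟩` of `H_X`. [cite: AroraBarak2009, §0.1] -/
def xMatF : List Bool → List Bool := fanoutFn mXx xRowsF
/-- The matrix code `⟨1^{mZ}, rows⟩` of `H_Z`. [cite: AroraBarak2009, §0.1] -/
def zMatF : List Bool → List Bool := fanoutFn mZx zRowsF
/-- The instance proper `⟨bin mX, ⟨bin mZ, ⟨bin nQ, ⟨H_X, H_Z⟩⟩⟩⟩`. [cite: KapshikarKundu2023, §4.1 (CSS input (H_X, H_Z))] -/
def instF : List Bool → List Bool :=
  fanoutFn (lenBinF ∘ mXx) (fanoutFn (lenBinF ∘ mZx) (fanoutFn (lenBinF ∘ nQx) (fanoutFn xMatF zMatF)))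
/-- **The map on genuine arguments**: `⟨instance, bin (min(w,m)+1)⟩`. [construction of this file] [cite: KapshikarKundu2023, §4.1 Corollary 3 (statement)] -/
def goodF : List Bool → List Bool := fanoutFn instF tauF

/-- `xRowF ∈ FP`. [cite: AroraBarak2009, §1.3 (polynomial time is closed under composition and bounded loops)] -/
theorem xRowF_mem_FP : xRowF ∈ FP :=
  comp_mem_FP (foldCat_mem_FP _ _ xbitF_mem_FP) (fanoutFn_mem_FP OracleCompose.id_mem_FP (comp_mem_FP nQx_mem_FP fstF_mem_FP))
/-- `zRowF ∈ FP`. [cite: AroraBarak2009, §1.3 (polynomial time is closed under composition and bounded loops)] -/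
theorem zRowF_mem_FP : zRowF ∈ FP :=
  comp_mem_FP (foldCat_mem_FP _ _ zbitF_mem_FP) (fanoutFn_mem_FP OracleCompose.id_mem_FP (comp_mem_FP nQx_mem_FP fstF_mem_FP))
/-- `xRowsF ∈ FP`. [cite: AroraBarak2009, §1.3 (polynomial time is closed under composition and bounded loops)] -/
theorem xRowsF_mem_FP : xRowsF ∈ FP :=
  comp_mem_FP (foldCat_mem_FP _ _ (fanoutFn_mem_FP xRowF_mem_FP (const_mem_FP _)))
    (fanoutFn_mem_FP OracleCompose.id_mem_FP mXx_mem_FP)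
/-- `zRowsF ∈ FP`. [cite: AroraBarak2009, §1.3 (polynomial time is closed under composition and bounded loops)] -/
theorem zRowsF_mem_FP : zRowsF ∈ FP :=
  comp_mem_FP (foldCat_mem_FP _ _ (fanoutFn_mem_FP zRowF_mem_FP (const_mem_FP _)))
    (fanoutFn_mem_FP OracleCompose.id_mem_FP mZx_mem_FP)
/-- **`goodF ∈ FP`.** [cite: AroraBarak2009, §1.3 (polynomial time is closed under composition and bounded loops)] -/
theorem goodF_mem_FP : goodF ∈ FP :=
  fanoutFn_mem_FP (fanoutFn_mem_FP (comp_mem_FP lenBinF_mem_FP mXx_mem_FP) (fanoutFn_mem_FP (comp_mem_FP lenBinF_mem_FP mZx_mem_FP)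
    (fanoutFn_mem_FP (comp_mem_FP lenBinF_mem_FP nQx_mem_FP)
      (fanoutFn_mem_FP (fanoutFn_mem_FP mXx_mem_FP xRowsF_mem_FP) (fanoutFn_mem_FP mZx_mem_FP zRowsF_mem_FP))))) tauF_mem_FP

section RowValues

variable (x : List Bool)


/-- **Value of `xRowF`.** [construction of this file] [cite: KapshikarKundu2023, §4.1 Corollary 3 (statement)] -/
theorem xRowF_apply (t : ℕ) : xRowF (boolPair x (ones t)) = xRowBits x t := by
  have hb : ∀ u, xbitF (boolPair (boolPair x (ones t)) (ones u)) = [xEntry (Abits x) (ybits x) (mhat x) t u] :=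
    fun u => xbitF_rec x t u
  rw [xRowF, Function.comp_apply, fanoutFn_apply, Function.comp_apply, fstF_boolPair, nQx_apply, id,
    foldCat_apply (by rw [List.length_replicate, eval_P3, length_boolPair]; exact nQ_hat_le x (by omega))
      (fun u _ => by rw [eval_one, hb, List.length_singleton]), List.length_replicate]
  simp only [hb]
  exact ThreeDM.ccat_single_eq_ofFn _ _

/-- **Value of `zRowF`.** [construction of this file] [cite: KapshikarKundu2023, §4.1 Corollary 3 (statement)] -/
theorem zRowF_apply (t : ℕ) : zRowF (boolPair x (ones t)) = zRowBits x t := by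
  have hb : ∀ u, zbitF (boolPair (boolPair x (ones t)) (ones u)) = [zEntry (Abits x) (mhat x) (nhat x) t u] :=
    fun u => zbitF_rec x t u
  rw [zRowF, Function.comp_apply, fanoutFn_apply, Function.comp_apply, fstF_boolPair, nQx_apply, id,
    foldCat_apply (by rw [List.length_replicate, eval_P3, length_boolPair]; exact nQ_hat_le x (by omega))
      (fun u _ => by rw [eval_one, hb, List.length_singleton]), List.length_replicate]
  simp only [hb]
  exact ThreeDM.ccat_single_eq_ofFn _ _

/-- Length of a row. [folklore] -/
private theorem length_xRowBits (t : ℕ) : (xRowBits x t).length = nQ (mhat x) (nhat x) := by rw [xRowBits, List.length_ofFn]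

/-- Length of a row. [folklore] -/
private theorem length_zRowBits (t : ℕ) : (zRowBits x t).length = nQ (mhat x) (nhat x) := by rw [zRowBits, List.length_ofFn]

/-- **Value of `xRowsF`**: the framed rows of `H_X`. [cite: AroraBarak2009, §0.1] -/
theorem xRowsF_apply : xRowsF x = ccat (fun t => boolPair (xRowBits x t) []) ((nhat x) * ((mhat x) + 1)) := by
  rw [xRowsF, Function.comp_apply, fanoutFn_apply, mXx_apply, id,
    foldCat_apply (by rw [List.length_replicate, eval_P3]; exact mX_hat_le x le_rfl)
      (fun t _ => by
        rw [xFrameF, fanoutFn_apply, xRowF_apply, length_boolPair, length_xRowBits, List.length_nil, eval_add, eval_mul,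
          eval_ofNat, eval_P3]
        have := nQ_hat_le x (le_refl x.length)
        omega), List.length_replicate]
  exact ccat_congr fun t _ => by rw [xFrameF, fanoutFn_apply, xRowF_apply]

/-- **Value of `zRowsF`**: the framed rows of `H_Z`. [cite: AroraBarak2009, §0.1] -/
theorem zRowsF_apply : zRowsF x = ccat (fun t => boolPair (zRowBits x t) []) (nQ (mhat x) (nhat x) + (mhat x)) := by
  rw [zRowsF, Function.comp_apply, fanoutFn_apply, mZx_apply, id,
    foldCat_apply (by
        rw [List.length_replicate, eval_add, eval_P3, eval_X]
        exact Nat.add_le_add (nQ_hat_le x le_rfl) (Nat.min_le_right _ _))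
      (fun t _ => by
        rw [zFrameF, fanoutFn_apply, zRowF_apply, length_boolPair, length_zRowBits, List.length_nil, eval_add, eval_mul,
          eval_ofNat, eval_P3]
        have := nQ_hat_le x (le_refl x.length)
        omega), List.length_replicate]
  exact ccat_congr fun t _ => by rw [zFrameF, fanoutFn_apply, zRowF_apply]

end RowValues

/-! ### The code of the instance -/

/-- The framed body of a list code is the concatenation of one-item frames (twin of
`Brick.frames_ofFn_eq_ccat_boolPair`, `SelectBricks.lean`, not in this import cone). [folklore] -/
private theorem frames_ofFn_eq_ccat (c : ℕ → List Bool) (k : ℕ) :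
    frames (List.ofFn fun i : Fin k => c i) = ccat (fun i => boolPair (c i) []) k := by
  rw [frames_ofFn]
  exact ccat_congr fun i _ => by rw [boolPair_eq, List.append_nil]

/-- The code of a row of bits given by a Boolean table. [cite: AroraBarak2009, §0.1] -/
private theorem encode_boolRow {K : ℕ} (g : Fin K → Bool) :
    (encodingF2Vec K).encode (fun u => if g u then (1 : ZMod 2) else 0) = List.ofFn g := by
  show (List.ofFn fun u : Fin K => decide ((if g u then (1 : ZMod 2) else 0) = 1)) = _
  congr 1
  funext u
  cases g u <;> decide

/-- The code of the machine's `H_X`. [cite: AroraBarak2009, §0.1] -/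
theorem encode_HXb (x : List Bool) :
    (encodingFinVec (encodingF2Vec (nQ (CosetWeightsNP.mhat x) (CosetWeightsNP.nhat x)))
        (CosetWeightsNP.nhat x * (CosetWeightsNP.mhat x + 1))).encode
      (HXb (Abits x) (ybits x) (CosetWeightsNP.mhat x) (CosetWeightsNP.nhat x)) =
      boolPair (ones (CosetWeightsNP.nhat x * (CosetWeightsNP.mhat x + 1)))
        (ccat (fun t => boolPair (xRowBits x t) []) (CosetWeightsNP.nhat x * (CosetWeightsNP.mhat x + 1))) := by
  rw [CosetWeights.encode_finVec_F2, ← frames_ofFn_eq_ccat]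
  congr 2
  exact List.ofFn_inj.2 (funext fun t => encode_boolRow _)

/-- The code of the machine's `H_Z`. [cite: AroraBarak2009, §0.1] -/
theorem encode_HZb (x : List Bool) :
    (encodingFinVec (encodingF2Vec (nQ (CosetWeightsNP.mhat x) (CosetWeightsNP.nhat x)))
        (nQ (CosetWeightsNP.mhat x) (CosetWeightsNP.nhat x) + CosetWeightsNP.mhat x)).encode
      (HZb (Abits x) (CosetWeightsNP.mhat x) (CosetWeightsNP.nhat x)) =
      boolPair (ones (nQ (CosetWeightsNP.mhat x) (CosetWeightsNP.nhat x) + CosetWeightsNP.mhat x))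
        (ccat (fun t => boolPair (zRowBits x t) []) (nQ (CosetWeightsNP.mhat x) (CosetWeightsNP.nhat x) + CosetWeightsNP.mhat x)) := by
  rw [CosetWeights.encode_finVec_F2, ← frames_ofFn_eq_ccat]
  congr 2
  exact List.ofFn_inj.2 (funext fun t => encode_boolRow _)

/-- **The code of the string instance.** [cite: AroraBarak2009, §0.1] -/
theorem encode_strInst (x : List Bool) (m n : ℕ) :
    (encodingCSSPair.pairBool encodingNatBool).encode (strInst x m n) =
      boolPair (boolPair (encodeNat (n * (m + 1))) (boolPair (encodeNat (nQ m n + m)) (boolPair (encodeNat (nQ m n))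
        (boolPair ((encodingFinVec (encodingF2Vec (nQ m n)) (n * (m + 1))).encode (HXb (Abits x) (ybits x) m n))
          ((encodingFinVec (encodingF2Vec (nQ m n)) (nQ m n + m)).encode (HZb (Abits x) m n))))))
        (encodeNat (min (CosetWeightsNP.wOf x) m + 1)) :=
  rfl

/-- **On any input the map `goodF` outputs the code of the string instance with the clamped sizes.**
[construction of this file] [cite: KapshikarKundu2023, §4.1 Corollary 3 (statement)] -/
theorem goodF_apply (x : List Bool) :
    goodF x = (encodingCSSPair.pairBool encodingNatBool).encode (strInst x (CosetWeightsNP.mhat x) (CosetWeightsNP.nhat x)) := by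
  rw [encode_strInst, encode_HXb, encode_HZb, goodF, fanoutFn_apply, instF, fanoutFn_apply, fanoutFn_apply,
    fanoutFn_apply, fanoutFn_apply, Function.comp_apply, mXx_apply, lenBinF_apply, List.length_replicate,
    Function.comp_apply, mZx_apply, lenBinF_apply, List.length_replicate, Function.comp_apply, nQx_apply, lenBinF_apply,
    List.length_replicate, xMatF, fanoutFn_apply, mXx_apply, xRowsF_apply, zMatF, fanoutFn_apply, mZx_apply,
    zRowsF_apply, tauF_apply]

/-! ### The reduction -/

/-- **The reduction function** `COSETWEIGHTS → CSSMINDIST`: on canonical instance codes the string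
instance, otherwise the fixed NO instance. [construction of this file] [cite: KapshikarKundu2023, §4.1 Corollary 3 (statement)] -/
def outF : List Bool → List Bool :=
  iteFn CosetWeightsNP.T goodF (fun _ => (encodingCSSPair.pairBool encodingNatBool).encode badI)

/-- **`outF ∈ FP`.** [cite: AroraBarak2009, §1.3] -/
theorem outF_mem_FP : outF ∈ FP := iteFn_mem_FP CosetWeightsNP.T_mem_FP goodF_mem_FP (const_mem_FP _)

/-- **Under the guard, the input is a YES instance of COSET WEIGHTS iff the output is a YES instance
of CSS-QMD.** [construction of this file] [cite: KapshikarKundu2023, §4.1 Corollary 3 (statement)] -/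
theorem mem_iff_of_guard {x : List Bool} (h : CosetWeightsNP.T x = [true]) : x ∈ COSETWEIGHTS ↔ outF x ∈ CSSMINDIST := by
  have hG : CosetWeightsNP.GoodShape x := (CosetWeightsNP.T_eq_true_iff x).1 h
  obtain ⟨hm, hn⟩ := clamps_of_goodShape hG
  have h1 : x ∈ COSETWEIGHTS ↔ CosetWeightsNP.instOf x ∈ cosetWeightsSet := by
    conv_lhs => rw [← CosetWeightsNP.encode_instOf hG]
    exact Computability.Encoding.mem_toLanguage_iff _ _ _
  rw [h1, outF, iteFn_apply_true h, goodF_apply, hm, hn, CSSMINDIST, Computability.Encoding.mem_toLanguage_iff,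
    strInst_mem_iff]

/-- Off the guard the output is the NO instance. [folklore] -/
private theorem outF_of_not_guard {x : List Bool} (h : ¬ CosetWeightsNP.T x = [true]) :
    outF x = (encodingCSSPair.pairBool encodingNatBool).encode badI := by
  rw [outF, iteFn_of_oneBit CosetWeightsNP.oneBit_T, if_neg h]

/-- **COSET WEIGHTS `≤ₚ` CSS-QMD**: the polynomial-time map `outF` sends the code of `(A, y, w)` to
the code of the CSS instance `flatInst m n A y w` — a YES instance iff `(A, y, w)` is
(`flat_mem_iff`) — and every other string to a NO instance. This is the reduction of this file
(not the printed one, see the module docstring). [cite: KapshikarKundu2023, §4.1 Corollary 3 (statement)] -/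
theorem COSETWEIGHTS_karpReducible_CSSMINDIST : COSETWEIGHTS ≤ₚ CSSMINDIST := by
  refine ⟨outF, outF_mem_FP, fun x => ?_⟩
  show x ∈ COSETWEIGHTS ↔ outF x ∈ CSSMINDIST
  by_cases hg : CosetWeightsNP.T x = [true]
  · exact mem_iff_of_guard hg
  · constructor
    · rintro ⟨I, -, rfl⟩
      exact absurd ((CosetWeightsNP.T_eq_true_iff _).2 (CosetWeightsNP.goodShape_encode I)) hg
    · intro hx
      rw [outF_of_not_guard hg] at hx
      exact absurd ((Computability.Encoding.mem_toLanguage_iff _ _ _).1 hx) badI_not_mem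

end CSSDistHard

/-- **Kapshikar–Kundu 2023, Corollary 3: the minimum-distance problem for CSS codes is NP-hard**
("The minimum distance problem for CSS codes is NP-hard", §4.1 Cor. 3) — DISCHARGE of the named fact
`KapshikarKundu2023_cssMinimumDistance_isNPHard`. Proof (this file, not the printed route): the
NP-hardness of COSET WEIGHTS (Berlekamp–McEliece–van Tilborg 1978, the tree's
`BerlekampMcElieceVanTilborg1978_cosetWeights_isNPHard`) transported along
`COSETWEIGHTS ≤ₚ CSSMINDIST` (`CSSDistHard.COSETWEIGHTS_karpReducible_CSSMINDIST`) by
`IsHard.of_reducible_holds`. [cite: KapshikarKundu2023, §4.1 Corollary 3] -/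
theorem KapshikarKundu2023_cssMinimumDistance_isNPHard_holds : KapshikarKundu2023_cssMinimumDistance_isNPHard :=
  IsHard.of_reducible_holds BerlekampMcElieceVanTilborg1978_cosetWeights_isNPHard
    CSSDistHard.COSETWEIGHTS_karpReducible_CSSMINDIST

end Literature.InformationTheory.QuantumCodes

end
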